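import Literature.Analysis.FluidPDE.Tao2016AveragedNS.TriggerFragility
import HarnessLib

/-!
# Tao 2016, §5.5 — trigger tolerance: Theorem 5.3 survives a seed-scale kick of the trigger

T. Tao, *Finite time blowup for an averaged three-dimensional Navier–Stokes equation*, J. Amer.
Math. Soc. **29** (2016) 601–674 = arXiv:1402.0290, §5.5, Theorem 5.3 and its proof (pp. 28–30 of
the arXiv version). [`Tao2016AveragedNS`]

HONEST FRAMING (cell pub-fluidc): part of a low prior, high value-of-information experiment on
Tao's machine paradigm; NOT a claim that NS blows up. This file is the LOWER (tolerance) half of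
the trigger channel of the delay circuit (5.5): `TriggerFragility.lean` showed that a pre-load
`κ ≥ kickThreshold ≈ ε²e^{-K¹⁰ + √2(C+2)K^{9.5} + …}` of the trigger mode `c` DESTROYS the
conclusion of Theorem 5.3 (the gate fires early); here we show that a pre-load
`0 ≤ κ ≤ kickTolerance K ε := ε² · e^{-K¹⁰ + K⁹√K/4}` is HARMLESS: every global solution of
(5.5) from the kicked datum `kickInit κ = (√(1-κ²), 0, κ, 0, 0)` still performs the delayed abrupt
energy transition with the SAME constants as the tree's proof of Theorem 5.3
(`DelayCircuitHolds.lean`: `C = 200`, `K ≥ K₀ = 8¹¹¹·111! + 2·20⁴²·42! + 16`,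
`0 < ε ≤ ε₁(K) = e^{-10K¹⁰}/K¹⁰⁰`) and the same critical window
`t_c ∈ [√2 - 1/√K, √2 + 1/√K]`. Together (`trigger_tolerance`): the kick tolerance of the
trigger channel is two-sidedly pinned to the seed scale, `seed · e^{Θ(K^{9.5})}` with
`seed = ε²e^{-K¹⁰}` — kernel-checked on both sides.

## Architecture
The proof is the printed bootstrap proof of Theorem 5.3 (pp. 28–30), re-run for the kicked datum;
the helper lemmas live in the sub-namespace `Thm53Kick` and mirror `Thm53.*` of
`DelayCircuitHolds.lean` one-for-one (same names, the hypothesis `h0 : X 0 = delayInit` replaced by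
the bundle `h0 : IsKicked K ε κ X`), the datum-free tools (`Thm53.antitoneOn_intFactor`,
`exists_hitTime`, `hasDerivAt_V`, `Es_alg`, the numerics) being reused as they stand. What changes:
* (energy-con): `kickInit κ` has energy one (`TriggerFragility.energy_kickInit`), so (est) and all
  the energy algebra are untouched; `|a(0) - 1| ≤ κ ≤ ε²/2` — `init_a_near`.
* (ob-2) `|b|,|c| ≤ 5ε` on `[0,2]`: comparison function `√(b²+c²+ε²-κ²)` (value `ε` at `t = 0`)
  instead of `√(b²+c²+ε²)` — `bc_small`, same constant.
* `c ≥ 0`: `TriggerFragility.kick_c_nonneg`; (code) `c ≤ (κe^{K¹⁰} + 2ε²)e^{(5t-1)K¹⁰}` — `c_crude`.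
* (able2) `|a - 1| ≤ 8K⁻²⁰`: the pump term is bounded by `ε²e^{-K¹⁰} ≤ ε²/2` (instead of `ε²`),
  which absorbs the initial offset `κ ≤ ε²/2` — `a_near_one`, same constant; (dora), (bogo-2)
  verbatim.
* sharp super-solution `c ≤ (κe^{K¹⁰} + 2ε²) exp(K¹⁰t²/2 + 1 - K¹⁰)` — `c_upper_sharp`; the
  sub-solution `c_lower_sharp` only improves (`κ ≥ 0`). Early side of (tcable): for
  `t ≤ √2 - 1/√K` the exponent is `≤ 1 - √2K⁹√K + K⁹/2`, and `κe^{K¹⁰} ≤ ε²e^{K⁹√K/4}` leaves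
  `(κe^{K¹⁰} + 2ε²)e^{…} ≤ 3ε²e^{1-K⁹} < K⁻¹⁰ε²` — `early_bound`, `numeric_early3`; this is where the
  exponent `K⁹√K/4 = K^{9.5}/4` of the tolerance is spent, and why the window is unchanged.
* after `t_c`: `c ≤ 3ε²e^{10K¹⁰}` on `[t_c,2]` (from (code) and the tolerance), so `νc² ≤ ε/16`
  needs `ε² ≤ e^{-20K¹⁰}/(144K¹⁰)` (the designed datum used `e^{-18K¹⁰}/(64K¹⁰)`; both follow from
  `ε ≤ ε₁(K)`) — `b_lower_after`, `eps_facts'`; everything later ((c-large), (cgrow-2), (douse),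
  (atc), (toke), (beable)) is verbatim.
* the hitting-time device needs `c(0) = κ < K⁻¹⁰ε²` — `IsKicked.lt_level`.
Exports: `kickTolerance`, `kick_hasAbruptTransition` and `kick_internal_timescales` (explicit
constants), `hasAbruptTransition_of_kick_le_tolerance` (Theorem 5.3-shaped), `kickInit_zero`
(`κ = 0` is the designed datum), `kickTolerance_lt_kickThreshold` and the two-sided package
`trigger_tolerance` (with `TriggerFragility.not_hasAbruptTransition_of_kick`).

## References
* T. Tao, JAMS 29 (2016) 601–674, arXiv:1402.0290, §5.5 Theorem 5.3 and proof. [`Tao2016AveragedNS`]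
-/

noncomputable section

namespace Literature.Analysis.FluidPDE.Tao2016AveragedNS

open Set Real Filter
open _root_.Topology

/-- The **trigger tolerance** `ε² · exp(-K¹⁰ + K⁹√K/4)`: a pre-load of the trigger mode `c` of
this size (`= seed · e^{K^{9.5}/4}`, `seed = ε²e^{-K¹⁰}` the pump rate `a → c`) does not disturb
the conclusion of Theorem 5.3. [cite: Tao2016AveragedNS, §5.5 proof of Theorem 5.3] -/
def kickTolerance (K ε : ℝ) : ℝ := ε ^ 2 * exp (-K ^ 10 + K ^ 9 * sqrt K / 4)

/-- The tolerance is positive (`ε ≠ 0`). [folklore] -/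
theorem kickTolerance_pos {K ε : ℝ} (hε : 0 < ε) : 0 < kickTolerance K ε := by
  unfold kickTolerance; positivity

namespace Thm53Kick

open Thm53 (antitoneOn_intFactor monotoneOn_intFactor antitoneOn_sub_of_deriv_le
  monotoneOn_sub_of_le_deriv exists_hitTime continuous_traj hasDerivAt_a hasDerivAt_b hasDerivAt_c
  hasDerivAt_d hasDerivAt_e abs_sub_le_of_abs_deriv_le sqrt_two_gt sqrt_two_lt invSqrt_facts
  exponent_late numeric_late hasDerivAt_V hasDerivAt_Es Es_alg decay_alg numeric_N3 numeric_N4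
  eps_facts)

/-! ## The kicked datum: the bundle of hypotheses on the kick size -/

/-- The standing hypotheses on the kick: the trajectory issues from `kickInit κ` with
`0 ≤ κ ≤ min(1, ε²/2)` and `κe^{K¹⁰} ≤ ε²e^{K⁹√K/4}` (i.e. `κ ≤ kickTolerance K ε`).
[cite: Tao2016AveragedNS, §5.5 (5.6)] -/
structure IsKicked (K ε κ : ℝ) (X : ℝ → Fin 5 → ℝ) : Prop where
  init : X 0 = kickInit κ
  nonneg : 0 ≤ κ
  le_one : κ ≤ 1
  le_half_sq : κ ≤ ε ^ 2 / 2
  le_tol : κ * exp (K ^ 10) ≤ ε ^ 2 * exp (K ^ 9 * sqrt K / 4)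

/-- `K⁹√K ≤ K¹⁰` for `K ≥ 1`. [folklore] -/
theorem pow9_sqrt_le {K : ℝ} (hK : 1 ≤ K) : K ^ 9 * sqrt K ≤ K ^ 10 := by
  have hK0 : 0 ≤ K := by linarith
  have h1 : 1 ≤ sqrt K := by
    rw [show (1 : ℝ) = sqrt 1 from sqrt_one.symm]; exact sqrt_le_sqrt hK
  have hs : sqrt K ≤ K := by nlinarith [mul_self_sqrt hK0, sqrt_nonneg K]
  calc K ^ 9 * sqrt K ≤ K ^ 9 * K := mul_le_mul_of_nonneg_left hs (by positivity)
    _ = K ^ 10 := by ring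

/-- `e^{-K¹⁰ + K⁹√K/4} ≤ 1/2` for `K ≥ 1`. [folklore] -/
theorem exp_tol_le_half {K : ℝ} (hK : 1 ≤ K) : exp (-K ^ 10 + K ^ 9 * sqrt K / 4) ≤ 1 / 2 := by
  have h94 := pow9_sqrt_le hK
  have hk1 : (1 : ℝ) ≤ K ^ 10 := one_le_pow₀ hK
  have h2e : (2 : ℝ) ≤ exp (3 / 4) := by
    have := Real.quadratic_le_exp_of_nonneg (show (0 : ℝ) ≤ 3 / 4 by norm_num)
    nlinarith
  calc exp (-K ^ 10 + K ^ 9 * sqrt K / 4) ≤ exp (-(3 / 4)) := exp_le_exp.2 (by nlinarith)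
    _ = 1 / exp (3 / 4) := by rw [exp_neg, one_div]
    _ ≤ 1 / 2 := one_div_le_one_div_of_le (by norm_num) h2e

section KickBundle

variable {K ε κ : ℝ} {X : ℝ → Fin 5 → ℝ}

/-- A kick below the tolerance satisfies the standing hypotheses (`K ≥ 1`, `0 < ε ≤ 1`).
[cite: Tao2016AveragedNS, §5.5 (5.6)] -/
theorem IsKicked.of_le_tolerance (hK : 1 ≤ K) (hε : 0 < ε) (hε1 : ε ≤ 1) (hκ0 : 0 ≤ κ)
    (hκ : κ ≤ kickTolerance K ε) (h0 : X 0 = kickInit κ) : IsKicked K ε κ X := by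
  have hhalf : κ ≤ ε ^ 2 / 2 := by
    calc κ ≤ ε ^ 2 * exp (-K ^ 10 + K ^ 9 * sqrt K / 4) := hκ
      _ ≤ ε ^ 2 * (1 / 2) := mul_le_mul_of_nonneg_left (exp_tol_le_half hK) (sq_nonneg ε)
      _ = ε ^ 2 / 2 := by ring
  have hε2 : ε ^ 2 ≤ 1 := by nlinarith
  refine ⟨h0, hκ0, by linarith, hhalf, ?_⟩
  calc κ * exp (K ^ 10) ≤ ε ^ 2 * exp (-K ^ 10 + K ^ 9 * sqrt K / 4) * exp (K ^ 10) :=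
        mul_le_mul_of_nonneg_right hκ (exp_pos _).le
    _ = ε ^ 2 * exp (K ^ 9 * sqrt K / 4) := by
        rw [mul_assoc, ← exp_add]; congr 2; ring

/-- `κ² ≤ 1`. [folklore] -/
theorem IsKicked.sq_le_one (h0 : IsKicked K ε κ X) : κ ^ 2 ≤ 1 :=
  pow_le_one₀ h0.nonneg h0.le_one

/-- The kick is below the trigger level of the bootstrap: `κ < K⁻¹⁰ε²` (`K ≥ 16`, `ε ≠ 0`), since
`κ ≤ ε²e^{-3K¹⁰/4}` and `K¹⁰ < e^{3K¹⁰/4}`. [cite: Tao2016AveragedNS, §5.5 (boots)] -/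
theorem IsKicked.lt_level (h0 : IsKicked K ε κ X) (hK : 16 ≤ K) (hε : 0 < ε) :
    κ < ε ^ 2 / K ^ 10 := by
  have hK1 : 1 ≤ K := by linarith
  set k : ℝ := K ^ 10 with hk
  have hk0 : 0 < k := by positivity
  have hk16 : 16 ≤ k := by
    have : (16 : ℝ) ^ 10 ≤ K ^ 10 := pow_le_pow_left₀ (by norm_num) hK 10
    simp only [hk]; nlinarith
  have h94 : K ^ 9 * sqrt K / 4 ≤ k / 4 := by have := pow9_sqrt_le hK1; simp only [hk]; linarith
  have h1 : κ * exp k ≤ ε ^ 2 * exp (k / 4) :=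
    h0.le_tol.trans (mul_le_mul_of_nonneg_left (exp_le_exp.2 h94) (sq_nonneg ε))
  have h2 : k * exp (k / 4) < exp k := by
    have hq := Real.quadratic_le_exp_of_nonneg (show (0 : ℝ) ≤ 3 * k / 4 by positivity)
    have h3 : k < exp (3 * k / 4) := by nlinarith
    calc k * exp (k / 4) < exp (3 * k / 4) * exp (k / 4) := mul_lt_mul_of_pos_right h3 (exp_pos _)
      _ = exp k := by rw [← exp_add]; congr 1; ring
  rw [lt_div_iff₀ hk0]
  by_contra hge
  have hge' : ε ^ 2 ≤ κ * k := not_lt.1 hge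
  have h4 : ε ^ 2 * exp k ≤ k * (κ * exp k) := by
    have := mul_le_mul_of_nonneg_right hge' (exp_pos k).le; linarith [this]
  have h5 : k * (κ * exp k) ≤ k * (ε ^ 2 * exp (k / 4)) := mul_le_mul_of_nonneg_left h1 hk0.le
  have h6 : ε ^ 2 * (k * exp (k / 4)) < ε ^ 2 * exp k := mul_lt_mul_of_pos_left h2 (pow_pos hε 2)
  nlinarith

/-- `|a(0) - 1| ≤ κ` for the kicked datum (`1 - κ ≤ √(1-κ²) ≤ 1`). [cite: Tao2016AveragedNS, §5.5 (5.6)] -/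
theorem init_a_near (h0 : IsKicked K ε κ X) : |X 0 0 - 1| ≤ κ := by
  have hκ0 := h0.nonneg
  have hκ1 := h0.le_one
  have ha : X 0 0 = sqrt (1 - κ ^ 2) := by simp [h0.init, kickInit]
  have hlow : 1 - κ ≤ sqrt (1 - κ ^ 2) := by
    calc 1 - κ = sqrt ((1 - κ) ^ 2) := (sqrt_sq (by linarith)).symm
      _ ≤ sqrt (1 - κ ^ 2) := sqrt_le_sqrt (by nlinarith)
  have hup : sqrt (1 - κ ^ 2) ≤ 1 := by
    simpa using sqrt_le_sqrt (show 1 - κ ^ 2 ≤ 1 by nlinarith)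
  rw [ha, abs_sub_comm, abs_of_nonneg (by linarith)]
  linarith

/-- (a-init), kicked: `b(0) = 0`. [cite: Tao2016AveragedNS, §5.5 (5.6)] -/
theorem init_b (h0 : IsKicked K ε κ X) : X 0 1 = 0 := kick_init_b h0.init
/-- (a-init), kicked: `c(0) = κ`. [cite: Tao2016AveragedNS, §5.5 (5.6)] -/
theorem init_c (h0 : IsKicked K ε κ X) : X 0 2 = κ := kick_init_c h0.init
/-- (a-init), kicked: `d(0) = 0`. [cite: Tao2016AveragedNS, §5.5 (5.6)] -/
theorem init_d (h0 : IsKicked K ε κ X) : X 0 3 = 0 := kick_init_d h0.init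
/-- (a-init), kicked: `ã(0) = 0`. [cite: Tao2016AveragedNS, §5.5 (5.6)] -/
theorem init_e (h0 : IsKicked K ε κ X) : X 0 4 = 0 := kick_init_e h0.init

end KickBundle

/-! ## Numerics for the early side of the critical window (the only place the tolerance is spent) -/

/-- Early side for the kicked datum: for `K ≥ 16`, `0 ≤ τ ≤ √2 - 1/√K` and a pre-load with
`λ ≤ ε²e^{K⁹√K/4}` (`λ = κe^{K¹⁰}`): `(λ + 2ε²) e^{K¹⁰τ²/2 + 1 - K¹⁰} ≤ 3ε² e^{1-K⁹}` (the exponent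
at `τ = √2 - s`, `s = 1/√K`, is `1 - √2K¹⁰s + K¹⁰s²/2 = 1 - √2K⁹√K + K⁹/2`, and
`(√2 - 1/4)√K ≥ 3/2`). [folklore] -/
theorem early_bound {K τ ε lam : ℝ} (hK : 16 ≤ K) (hτ0 : 0 ≤ τ) (hτ : τ ≤ sqrt 2 - (sqrt K)⁻¹)
    (hlam : lam ≤ ε ^ 2 * exp (K ^ 9 * sqrt K / 4)) :
    (lam + 2 * ε ^ 2) * exp (K ^ 10 * τ ^ 2 / 2 + 1 - K ^ 10) ≤ 3 * ε ^ 2 * exp (1 - K ^ 9) := by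
  obtain ⟨hs0, hs4, hKs, h4, hKs2⟩ := invSqrt_facts hK
  set s := (sqrt K)⁻¹ with hs
  have hK0 : 0 < K := by linarith
  have h2 : sqrt 2 ^ 2 = 2 := sq_sqrt (by norm_num)
  have h72 := sqrt_two_gt
  have hst : 0 ≤ sqrt 2 - s := by linarith
  have hτ2 : τ ^ 2 ≤ (sqrt 2 - s) ^ 2 := pow_le_pow_left₀ hτ0 hτ 2
  have hsq : (sqrt 2 - s) ^ 2 = 2 - 2 * sqrt 2 * s + s ^ 2 := by ring_nf; rw [h2]; ring
  have hk9s : K ^ 10 * s = K ^ 9 * sqrt K := by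
    rw [show K ^ 10 * s = K ^ 9 * (K * s) by ring, hKs]
  have hk9 : K ^ 10 * s ^ 2 = K ^ 9 := by
    rw [show K ^ 10 * s ^ 2 = K ^ 9 * (K * s ^ 2) by ring, hKs2, mul_one]
  have hexpo : K ^ 10 * τ ^ 2 / 2 + 1 - K ^ 10 ≤ 1 - sqrt 2 * (K ^ 9 * sqrt K) + K ^ 9 / 2 := by
    have h1 : K ^ 10 * τ ^ 2 ≤ K ^ 10 * (sqrt 2 - s) ^ 2 :=
      mul_le_mul_of_nonneg_left hτ2 (by positivity)
    have h3 : K ^ 10 * (sqrt 2 - s) ^ 2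
        = 2 * K ^ 10 - 2 * sqrt 2 * (K ^ 10 * s) + K ^ 10 * s ^ 2 := by rw [hsq]; ring
    rw [hk9s, hk9] at h3
    linarith
  have hK9 : 0 < K ^ 9 := by positivity
  have hmain : K ^ 9 * sqrt K / 4 + (1 - sqrt 2 * (K ^ 9 * sqrt K) + K ^ 9 / 2) ≤ 1 - K ^ 9 := by
    have h32 : 3 / 2 ≤ (sqrt 2 - 1 / 4) * sqrt K := by
      nlinarith [mul_nonneg (sub_nonneg.2 h72.le) (show (0 : ℝ) ≤ sqrt K by linarith)]
    have : 0 ≤ K ^ 9 * ((sqrt 2 - 1 / 4) * sqrt K - 3 / 2) := mul_nonneg hK9.le (by linarith)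
    nlinarith
  have h3 : lam + 2 * ε ^ 2 ≤ 3 * ε ^ 2 * exp (K ^ 9 * sqrt K / 4) := by
    have h1e : (1 : ℝ) ≤ exp (K ^ 9 * sqrt K / 4) := by
      have := Real.add_one_le_exp (K ^ 9 * sqrt K / 4)
      have : 0 ≤ K ^ 9 * sqrt K / 4 := by positivity
      linarith
    nlinarith [sq_nonneg ε]
  calc (lam + 2 * ε ^ 2) * exp (K ^ 10 * τ ^ 2 / 2 + 1 - K ^ 10)
      ≤ (3 * ε ^ 2 * exp (K ^ 9 * sqrt K / 4)) * exp (1 - sqrt 2 * (K ^ 9 * sqrt K) + K ^ 9 / 2) :=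
        mul_le_mul h3 (exp_le_exp.2 hexpo) (exp_pos _).le (by positivity)
    _ = 3 * ε ^ 2 * exp (K ^ 9 * sqrt K / 4 + (1 - sqrt 2 * (K ^ 9 * sqrt K) + K ^ 9 / 2)) := by
        rw [mul_assoc (3 * ε ^ 2), ← exp_add]
    _ ≤ 3 * ε ^ 2 * exp (1 - K ^ 9) :=
        mul_le_mul_of_nonneg_left (exp_le_exp.2 hmain) (by positivity)

/-- `3e·e^{-K⁹} < K⁻¹⁰` for `K ≥ 2` (since `e^{K⁹} ≥ K¹⁸/2` and `K⁸ ≥ 256 > 6e`). [folklore] -/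
theorem numeric_early3 {K : ℝ} (hK : 2 ≤ K) : 3 * exp (1 - K ^ 9) < 1 / K ^ 10 := by
  have hK0 : 0 < K := by linarith
  have h8 : (2 : ℝ) ^ 8 ≤ K ^ 8 := pow_le_pow_left₀ (by norm_num) hK 8
  have he : exp 1 < 2.7182818286 := Real.exp_one_lt_d9
  have hexp : (K ^ 9) ^ 2 / 2 ≤ exp (K ^ 9) := by
    have := Real.pow_div_factorial_le_exp (x := K ^ 9) (hx := by positivity) (n := 2)
    simpa [Nat.factorial] using this
  have key : 3 * exp 1 * K ^ 10 < exp (K ^ 9) :=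
    calc 3 * exp 1 * K ^ 10 < 3 * 2.7182818286 * K ^ 10 := by
          have : 0 < K ^ 10 := by positivity
          nlinarith
      _ ≤ (K ^ 9) ^ 2 / 2 := by
          have h18 : (K ^ 9) ^ 2 = K ^ 8 * K ^ 10 := by ring
          rw [h18]
          nlinarith [pow_pos hK0 10]
      _ ≤ exp (K ^ 9) := hexp
  rw [Real.exp_sub, show 3 * (exp 1 / exp (K ^ 9)) = (3 * exp 1) / exp (K ^ 9) by ring,
    div_lt_div_iff₀ (exp_pos _) (by positivity), one_mul]
  exact key

/-- The smallness of `ε ≤ ε₁(K) = e^{-10K¹⁰}/K¹⁰⁰` in the form used after `t_c` for the kicked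
datum: `ε² ≤ e^{-20K¹⁰}/(144K¹⁰)`. [folklore] -/
theorem eps_facts' {K ε : ℝ} (hK : 16 ≤ K) (hε : 0 < ε)
    (hεle : ε ≤ exp (-(10 * K ^ 10)) / K ^ 100) :
    ε ^ 2 ≤ exp (-(20 * K ^ 10)) / (144 * K ^ 10) := by
  have hK0 : 0 < K := by linarith
  have hsq : ε ^ 2 ≤ (exp (-(10 * K ^ 10)) / K ^ 100) ^ 2 := pow_le_pow_left₀ hε.le hεle 2
  refine hsq.trans ?_
  rw [div_pow, div_le_div_iff₀ (by positivity) (by positivity)]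
  have he : exp (-(10 * K ^ 10)) ^ 2 ≤ exp (-(20 * K ^ 10)) := by
    rw [← exp_nat_mul, exp_le_exp]; push_cast; nlinarith [pow_pos hK0 10]
  have hp : 144 * K ^ 10 ≤ (K ^ 100) ^ 2 := by
    calc 144 * K ^ 10 ≤ K ^ 190 * K ^ 10 := by
          have : (144 : ℝ) ≤ K ^ 190 := by
            have : (16 : ℝ) ^ 190 ≤ K ^ 190 := pow_le_pow_left₀ (by norm_num) hK 190
            linarith
          exact mul_le_mul_of_nonneg_right this (by positivity)
      _ = (K ^ 100) ^ 2 := by ring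
  exact mul_le_mul he hp (by positivity) (exp_pos _).le

/-! ## The trajectory: components, energy, signs -/

section Trajectory

variable {K ε κ : ℝ} {X : ℝ → Fin 5 → ℝ}

/-- (energy-con) in components, kicked datum. [cite: Tao2016AveragedNS, §5.5 (energy-con)] -/
theorem traj_sum_sq_eq_one (hX : ∀ t, HasDerivAt X (delayCircuit K ε (X t)) t)
    (h0 : IsKicked K ε κ X) (t : ℝ) :
    X t 0 ^ 2 + X t 1 ^ 2 + X t 2 ^ 2 + X t 3 ^ 2 + X t 4 ^ 2 = 1 := by
  have h := kick_energy hX h0.init h0.sq_le_one t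
  simpa [energy, Fin.sum_univ_five] using h

/-- (est): every mode is `O(1)`. [cite: Tao2016AveragedNS, §5.5 (est)] -/
theorem traj_sq_le_one (hX : ∀ t, HasDerivAt X (delayCircuit K ε (X t)) t)
    (h0 : IsKicked K ε κ X) (t : ℝ) (i : Fin 5) : X t i ^ 2 ≤ 1 :=
  kick_sq_le_one hX h0.init h0.sq_le_one t i

/-- (est): `|Xᵢ| ≤ 1`. [cite: Tao2016AveragedNS, §5.5 (est)] -/
theorem traj_abs_le_one (hX : ∀ t, HasDerivAt X (delayCircuit K ε (X t)) t)
    (h0 : IsKicked K ε κ X) (t : ℝ) (i : Fin 5) : |X t i| ≤ 1 :=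
  sq_le_one_iff_abs_le_one _ |>.1 (traj_sq_le_one hX h0 t i)

/-- `ã ≥ 0` for `t ≥ 0` (it is non-decreasing from `0`). [cite: Tao2016AveragedNS, §5.5 proof] -/
theorem e_nonneg (hX : ∀ t, HasDerivAt X (delayCircuit K ε (X t)) t) (h0 : IsKicked K ε κ X)
    (hK : 0 ≤ K) {t : ℝ} (ht : 0 ≤ t) : 0 ≤ X t 4 := by
  have := delayCircuit_output_monotone hK hX ht
  simpa [init_e h0] using this

/-! ## (ob-2): `b, c = O(ε)` on `[0,2]` -/

/-- (ob-2), quantitatively: `|b|, |c| ≤ 5ε` on `[0,2]`, from the local energy identity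
`∂ₜ(b²+c²) = 2εa²b + 2μa²c` applied to `√(b²+c²+ε²-κ²)` (value `ε` at `t = 0`; the kick has
`κ ≤ ε²/2 < ε`). [cite: Tao2016AveragedNS, §5.5 (ob-2)] -/
theorem bc_small (hX : ∀ t, HasDerivAt X (delayCircuit K ε (X t)) t) (h0 : IsKicked K ε κ X)
    (hε : 0 < ε) (hε1 : ε ≤ 1) {t : ℝ} (ht : t ∈ Icc 0 2) :
    |X t 1| ≤ 5 * ε ∧ |X t 2| ≤ 5 * ε := by
  -- the kick is strictly below `ε`: `κ ≤ ε²/2 ≤ ε/2`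
  have hκ0 : 0 ≤ κ := h0.nonneg
  have hκε : κ ^ 2 < ε ^ 2 := by
    have h1 : κ ≤ ε / 2 := h0.le_half_sq.trans (by nlinarith)
    nlinarith
  set f : ℝ → ℝ := fun s => X s 1 ^ 2 + X s 2 ^ 2 with hf
  set h : ℝ → ℝ := fun s => sqrt (f s + (ε ^ 2 - κ ^ 2)) with hh
  have hfpos : ∀ s, 0 < f s + (ε ^ 2 - κ ^ 2) := fun s => by
    have : 0 ≤ f s := by positivity
    linarith
  have hb_le : ∀ s, |X s 1| ≤ h s := fun s =>
    abs_le_sqrt (by simp only [hf]; nlinarith [sq_nonneg (X s 2)])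
  have hc_le : ∀ s, |X s 2| ≤ h s := fun s =>
    abs_le_sqrt (by simp only [hf]; nlinarith [sq_nonneg (X s 1)])
  have hder : ∀ s, HasDerivAt h
      ((2 * ε * X s 0 ^ 2 * X s 1 + 2 * ε ^ 2 * exp (-K ^ 10) * X s 0 ^ 2 * X s 2)
        / (2 * sqrt (f s + (ε ^ 2 - κ ^ 2)))) s := fun s =>
    ((delayCircuit_bc_energy (hX s)).add_const (ε ^ 2 - κ ^ 2)).sqrt (hfpos s).ne'
  have hbound : ∀ s, (2 * ε * X s 0 ^ 2 * X s 1 + 2 * ε ^ 2 * exp (-K ^ 10) * X s 0 ^ 2 * X s 2)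
        / (2 * sqrt (f s + (ε ^ 2 - κ ^ 2))) ≤ 2 * ε := by
    intro s
    have hhpos : 0 < sqrt (f s + (ε ^ 2 - κ ^ 2)) := sqrt_pos.2 (hfpos s)
    rw [div_le_iff₀ (by positivity)]
    have ha : X s 0 ^ 2 ≤ 1 := traj_sq_le_one hX h0 s 0
    have ha0 : 0 ≤ X s 0 ^ 2 := sq_nonneg _
    have hek : exp (-K ^ 10) ≤ 1 := by
      rw [exp_le_one_iff, neg_nonpos]; positivity
    have hbs : |X s 1| ≤ h s := hb_le s
    have hcs : |X s 2| ≤ h s := hc_le s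
    have hb1 : X s 1 ≤ h s := (le_abs_self _).trans hbs
    have hc1 : X s 2 ≤ h s := (le_abs_self _).trans hcs
    have hc2 : -h s ≤ X s 2 := by have := neg_abs_le (X s 2); linarith
    have hh0 : 0 ≤ h s := (abs_nonneg _).trans hbs
    -- `a² b ≤ h`, `ε² e^{-k} a² c ≤ ε h`
    have h1 : X s 0 ^ 2 * X s 1 ≤ h s := by nlinarith
    have h21 : ε ^ 2 * exp (-K ^ 10) ≤ ε := by
      calc ε ^ 2 * exp (-K ^ 10) ≤ ε ^ 2 * 1 :=
            mul_le_mul_of_nonneg_left hek (sq_nonneg _)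
        _ = ε * ε := by ring
        _ ≤ ε * 1 := mul_le_mul_of_nonneg_left hε1 hε.le
        _ = ε := mul_one _
    have hεe : 0 ≤ ε ^ 2 * exp (-K ^ 10) := by positivity
    have h22 : |X s 0 ^ 2 * X s 2| ≤ h s := by
      rw [abs_mul, abs_of_nonneg ha0]; nlinarith [abs_nonneg (X s 2)]
    have h23 : ε ^ 2 * exp (-K ^ 10) * (X s 0 ^ 2 * X s 2) ≤ ε * h s := by
      calc ε ^ 2 * exp (-K ^ 10) * (X s 0 ^ 2 * X s 2)
          ≤ ε ^ 2 * exp (-K ^ 10) * |X s 0 ^ 2 * X s 2| :=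
            mul_le_mul_of_nonneg_left (le_abs_self _) hεe
        _ ≤ ε * h s := mul_le_mul h21 h22 (abs_nonneg _) hε.le
    have : h s = sqrt (f s + (ε ^ 2 - κ ^ 2)) := rfl
    rw [← this]
    nlinarith
  -- `h - 2εt` is antitone on `[0,2]`
  have hanti := antitoneOn_sub_of_deriv_le (convex_Icc 0 2) (fun s _ => hder s)
    (fun s _ => ((hasDerivAt_id s).const_mul (2 * ε))) (fun s _ => by simpa using hbound s)
  have h0mem : (0 : ℝ) ∈ Icc (0 : ℝ) 2 := ⟨le_rfl, by norm_num⟩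
  have hmono := hanti h0mem ht ht.1
  have hh0 : h 0 = ε := by
    have : f 0 + (ε ^ 2 - κ ^ 2) = ε ^ 2 := by simp only [hf, init_b h0, init_c h0]; ring
    simp only [hh, this, sqrt_sq hε.le]
  simp only [hh0, id, mul_zero, sub_zero] at hmono
  have hht : h t ≤ 5 * ε := by
    have := ht.2
    nlinarith
  exact ⟨(hb_le t).trans hht, (hc_le t).trans hht⟩

/-! ## `c ≥ 0` and the crude Grönwall bound (code) -/

/-- `c(t) ≥ 0` for `t ≥ 0` (comparison argument, integrating factor `exp(-∫₀ᵗ ε⁻¹K¹⁰ b)`; the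
kick `κ ≥ 0` only helps). [cite: Tao2016AveragedNS, §5.5 proof] -/
theorem c_nonneg (hX : ∀ t, HasDerivAt X (delayCircuit K ε (X t)) t) (h0 : IsKicked K ε κ X)
    {t : ℝ} (ht : 0 ≤ t) : 0 ≤ X t 2 :=
  kick_c_nonneg hX h0.init h0.nonneg ht

/-- (code), kicked: the crude Grönwall bound `c(t) ≤ (κe^{K¹⁰} + 2ε²) e^{(5t-1)K¹⁰}` on `[0,2]`
(from `∂ₜc ≤ μ + 5K¹⁰ c`, `c(0) = κ`). [cite: Tao2016AveragedNS, §5.5 (code)] -/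
theorem c_crude (hX : ∀ t, HasDerivAt X (delayCircuit K ε (X t)) t) (h0 : IsKicked K ε κ X)
    (hε : 0 < ε) (hε1 : ε ≤ 1) {t : ℝ} (ht : t ∈ Icc 0 2) :
    X t 2 ≤ (κ * exp (K ^ 10) + 2 * ε ^ 2) * exp ((5 * t - 1) * K ^ 10) := by
  set μ := ε ^ 2 * exp (-K ^ 10) with hμ
  have hμ0 : 0 ≤ μ := by positivity
  have hanti := antitoneOn_intFactor (s := Icc 0 2) (g := fun _ => 5 * K ^ 10)
    (G := fun s => 5 * K ^ 10 * s) (φ := fun _ => μ) (Φ := fun s => μ * s) (convex_Icc 0 2)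
    (fun s _ => hasDerivAt_c hX s)
    (fun s _ => ((hasDerivAt_id s).const_mul (5 * K ^ 10)).congr_deriv (by simp))
    (fun s _ => ((hasDerivAt_id s).const_mul μ).congr_deriv (by simp))
    (fun s hs => by
      have hc0 : 0 ≤ X s 2 := c_nonneg hX h0 hs.1
      have hb : |X s 1| ≤ 5 * ε := (bc_small hX h0 hε hε1 hs).1
      have ha : X s 0 ^ 2 ≤ 1 := traj_sq_le_one hX h0 s 0
      have hexp : exp (-(5 * K ^ 10 * s)) ≤ 1 := by
        rw [exp_le_one_iff, neg_nonpos]; have := hs.1; positivity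
      have hk : 0 ≤ K ^ 10 := by positivity
      have h1 : ε ^ 2 * exp (-K ^ 10) * X s 0 ^ 2 ≤ μ := by
        simpa [hμ] using mul_le_mul_of_nonneg_left ha (by positivity : 0 ≤ ε ^ 2 * exp (-K ^ 10))
      have h2 : ε⁻¹ * K ^ 10 * X s 1 * X s 2 ≤ 5 * K ^ 10 * X s 2 := by
        have hb' : X s 1 ≤ 5 * ε := (le_abs_self _).trans hb
        have h5 : ε⁻¹ * X s 1 ≤ 5 := by
          rw [inv_mul_le_iff₀ hε]; linarith
        have : ε⁻¹ * K ^ 10 * X s 1 * X s 2 = (ε⁻¹ * X s 1) * (K ^ 10 * X s 2) := by ring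
        rw [this]
        nlinarith [mul_nonneg hk hc0]
      have hbr : ε ^ 2 * exp (-K ^ 10) * X s 0 ^ 2 + ε⁻¹ * K ^ 10 * X s 1 * X s 2
          - 5 * K ^ 10 * X s 2 ≤ μ := by linarith
      calc (ε ^ 2 * exp (-K ^ 10) * X s 0 ^ 2 + ε⁻¹ * K ^ 10 * X s 1 * X s 2
            - 5 * K ^ 10 * X s 2) * exp (-(5 * K ^ 10 * s))
          ≤ μ * exp (-(5 * K ^ 10 * s)) := mul_le_mul_of_nonneg_right hbr (exp_pos _).le
        _ ≤ μ * 1 := mul_le_mul_of_nonneg_left hexp hμ0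
        _ = μ := mul_one _)
  have h0mem : (0 : ℝ) ∈ Icc (0 : ℝ) 2 := ⟨le_rfl, by norm_num⟩
  have h := hanti h0mem ht ht.1
  simp only [init_c h0, mul_zero, neg_zero, exp_zero, mul_one, sub_zero] at h
  -- `c t * exp(-5kt) - μ t ≤ κ`
  have h' : X t 2 * exp (-(5 * K ^ 10 * t)) ≤ κ + μ * 2 := by
    have := mul_le_mul_of_nonneg_left ht.2 hμ0; linarith
  have hexp : X t 2 = X t 2 * exp (-(5 * K ^ 10 * t)) * exp (5 * K ^ 10 * t) := by
    rw [mul_assoc, ← exp_add, neg_add_cancel, exp_zero, mul_one]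
  rw [hexp]
  have hee : exp (K ^ 10) * exp (-K ^ 10) = 1 := by rw [← exp_add, add_neg_cancel, exp_zero]
  calc X t 2 * exp (-(5 * K ^ 10 * t)) * exp (5 * K ^ 10 * t)
      ≤ (κ + μ * 2) * exp (5 * K ^ 10 * t) := mul_le_mul_of_nonneg_right h' (exp_pos _).le
    _ = (κ * exp (K ^ 10) + 2 * ε ^ 2) * exp ((5 * t - 1) * K ^ 10) := by
        simp only [hμ]
        rw [show (5 * t - 1) * K ^ 10 = -K ^ 10 + 5 * K ^ 10 * t by ring, exp_add]
        linear_combination (-(κ * exp (5 * K ^ 10 * t))) * hee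

end Trajectory

section PhaseOne

/-! ## Up to the critical time: (dora), (able2), (bogo-2) and the sharp comparison for `c`

Throughout, `τ` is a time with `c ≤ K⁻¹⁰ε²` on `[0,τ]` ((boots); it will be the hitting time). -/

variable {K ε κ τ : ℝ} {X : ℝ → Fin 5 → ℝ}

/-- (dora): `|d|, |ã| ≤ 3K⁻¹⁰` on `[0,τ]`, from `∂ₜ(d²+ã²) = 2ε⁻²c·a·d` applied to
`√(d²+ã²+K⁻²⁰)`. [cite: Tao2016AveragedNS, §5.5 (dora)] -/
theorem de_small (hX : ∀ t, HasDerivAt X (delayCircuit K ε (X t)) t) (h0 : IsKicked K ε κ X)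
    (hε : 0 < ε) (hK : 0 < K) (hτ2 : τ ≤ 2)
    (hcτ : ∀ t, 0 ≤ t → t ≤ τ → X t 2 ≤ ε ^ 2 / K ^ 10)
    {t : ℝ} (ht : t ∈ Icc 0 τ) : |X t 3| ≤ 3 / K ^ 10 ∧ |X t 4| ≤ 3 / K ^ 10 := by
  set q : ℝ := (K ^ 10)⁻¹ with hq
  have hq0 : 0 < q := by positivity
  set u : ℝ → ℝ := fun s => X s 3 ^ 2 + X s 4 ^ 2 with hu
  set h : ℝ → ℝ := fun s => sqrt (u s + q ^ 2) with hh
  have hupos : ∀ s, 0 < u s + q ^ 2 := fun s => by positivity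
  have hd_le : ∀ s, |X s 3| ≤ h s := fun s =>
    abs_le_sqrt (by simp only [hu]; nlinarith [sq_nonneg (X s 4)])
  have he_le : ∀ s, |X s 4| ≤ h s := fun s =>
    abs_le_sqrt (by simp only [hu]; nlinarith [sq_nonneg (X s 3)])
  have hder : ∀ s, HasDerivAt h
      ((2 * (ε ^ 2)⁻¹ * X s 2 * X s 0 * X s 3) / (2 * sqrt (u s + q ^ 2))) s := fun s =>
    ((delayCircuit_out_energy (hX s)).add_const (q ^ 2)).sqrt (hupos s).ne'
  have hbound : ∀ s ∈ Icc 0 τ,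
      (2 * (ε ^ 2)⁻¹ * X s 2 * X s 0 * X s 3) / (2 * sqrt (u s + q ^ 2)) ≤ q := by
    intro s hs
    have hhpos : 0 < sqrt (u s + q ^ 2) := sqrt_pos.2 (hupos s)
    rw [div_le_iff₀ (by positivity)]
    have hc0 : 0 ≤ X s 2 := c_nonneg hX h0 hs.1
    have hcθ : X s 2 ≤ ε ^ 2 / K ^ 10 := hcτ s hs.1 hs.2
    have ha : |X s 0| ≤ 1 := traj_abs_le_one hX h0 s 0
    have hds : |X s 3| ≤ h s := hd_le s
    have hh' : h s = sqrt (u s + q ^ 2) := rfl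
    rw [← hh']
    have h1 : |X s 0 * X s 3| ≤ h s := by
      rw [abs_mul]
      calc |X s 0| * |X s 3| ≤ 1 * h s := mul_le_mul ha hds (abs_nonneg _) zero_le_one
        _ = h s := one_mul _
    have h2 : (ε ^ 2)⁻¹ * X s 2 ≤ q := by
      calc (ε ^ 2)⁻¹ * X s 2 ≤ (ε ^ 2)⁻¹ * (ε ^ 2 / K ^ 10) :=
            mul_le_mul_of_nonneg_left hcθ (by positivity)
        _ = q := by simp only [hq]; field_simp
    have h3 : 0 ≤ (ε ^ 2)⁻¹ * X s 2 := by positivity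
    have h4 : (ε ^ 2)⁻¹ * X s 2 * (X s 0 * X s 3) ≤ q * h s :=
      calc (ε ^ 2)⁻¹ * X s 2 * (X s 0 * X s 3) ≤ (ε ^ 2)⁻¹ * X s 2 * |X s 0 * X s 3| :=
            mul_le_mul_of_nonneg_left (le_abs_self _) h3
        _ ≤ q * h s := mul_le_mul h2 h1 (abs_nonneg _) hq0.le
    have : 2 * (ε ^ 2)⁻¹ * X s 2 * X s 0 * X s 3 = 2 * ((ε ^ 2)⁻¹ * X s 2 * (X s 0 * X s 3)) := by
      ring
    rw [this]
    linarith
  have hanti := antitoneOn_sub_of_deriv_le (Φ := fun s => q * s) (convex_Icc 0 τ)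
    (fun s _ => hder s) (fun s _ => ((hasDerivAt_id s).const_mul q).congr_deriv (by simp)) hbound
  have h0mem : (0 : ℝ) ∈ Icc (0 : ℝ) τ := ⟨le_rfl, ht.1.trans ht.2⟩
  have hmono := hanti h0mem ht ht.1
  have hh0 : h 0 = q := by
    simp only [hh, hu, init_d h0, init_e h0]
    simpa using sqrt_sq hq0.le
  simp only [hh0, mul_zero, sub_zero] at hmono
  have hht : h t ≤ 3 / K ^ 10 := by
    have ht2 : t ≤ 2 := ht.2.trans hτ2
    have : h t ≤ q + q * t := by linarith
    calc h t ≤ q + q * t := this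
      _ ≤ q + q * 2 := by nlinarith
      _ = 3 / K ^ 10 := by simp only [hq]; ring
  exact ⟨(hd_le t).trans hht, (he_le t).trans hht⟩

/-- (able2) for `a`, kicked: `|a - 1| ≤ 8K⁻²⁰` on `[0,τ]` (from `∂ₜa = O(K⁻²⁰) + O(ε²)`; the pump
term is bounded by `ε²e^{-K¹⁰} ≤ ε²/2`, which absorbs the initial offset `|a(0)-1| ≤ κ ≤ ε²/2`).
[cite: Tao2016AveragedNS, §5.5 (able2)] -/
theorem a_near_one (hX : ∀ t, HasDerivAt X (delayCircuit K ε (X t)) t) (h0 : IsKicked K ε κ X)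
    (hε : 0 < ε) (hε1 : ε ≤ 1) (hK : 1 ≤ K) (hτ2 : τ ≤ 2)
    (hεK : ε ^ 2 ≤ 1 / (6 * K ^ 20))
    (hcτ : ∀ t, 0 ≤ t → t ≤ τ → X t 2 ≤ ε ^ 2 / K ^ 10)
    {t : ℝ} (ht : t ∈ Icc 0 τ) : |X t 0 - 1| ≤ 8 / K ^ 20 := by
  have hK0 : 0 < K := by linarith
  have h6 : 6 * ε ^ 2 ≤ 1 / K ^ 20 := by
    have := hεK
    rw [le_div_iff₀ (by positivity)] at this
    rw [le_div_iff₀ (by positivity)]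
    linarith
  have hek2 : exp (-K ^ 10) ≤ 1 / 2 := by
    have hk1 : (1 : ℝ) ≤ K ^ 10 := one_le_pow₀ hK
    have h2e : (2 : ℝ) ≤ exp 1 := by
      have := Real.add_one_le_exp (1 : ℝ); norm_num at this ⊢; linarith
    calc exp (-K ^ 10) ≤ exp (-1) := exp_le_exp.2 (by linarith)
      _ = 1 / exp 1 := by rw [exp_neg, one_div]
      _ ≤ 1 / 2 := one_div_le_one_div_of_le (by norm_num) h2e
  have hM : ∀ s ∈ Icc 0 τ, |(-((ε ^ 2)⁻¹ * X s 2 * X s 3) - ε * X s 0 * X s 1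
      - ε ^ 2 * exp (-K ^ 10) * X s 0 * X s 2)| ≤ 3 / K ^ 20 + 11 * ε ^ 2 / 2 := by
    intro s hs
    have hs2 : s ∈ Icc (0 : ℝ) 2 := ⟨hs.1, hs.2.trans hτ2⟩
    have hc0 : 0 ≤ X s 2 := c_nonneg hX h0 hs.1
    have hcθ : X s 2 ≤ ε ^ 2 / K ^ 10 := hcτ s hs.1 hs.2
    have hd : |X s 3| ≤ 3 / K ^ 10 := (de_small hX h0 hε hK0 hτ2 hcτ hs).1
    have ha : |X s 0| ≤ 1 := traj_abs_le_one hX h0 s 0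
    have hb : |X s 1| ≤ 5 * ε := (bc_small hX h0 hε hε1 hs2).1
    have hc1 : |X s 2| ≤ 1 := traj_abs_le_one hX h0 s 2
    -- term 1: `|ρ c d| ≤ 3 K⁻²⁰`
    have h1 : |(ε ^ 2)⁻¹ * X s 2 * X s 3| ≤ 3 / K ^ 20 := by
      rw [abs_mul, abs_of_nonneg (by positivity : 0 ≤ (ε ^ 2)⁻¹ * X s 2)]
      calc (ε ^ 2)⁻¹ * X s 2 * |X s 3| ≤ (ε ^ 2)⁻¹ * (ε ^ 2 / K ^ 10) * (3 / K ^ 10) :=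
            mul_le_mul (mul_le_mul_of_nonneg_left hcθ (by positivity)) hd (abs_nonneg _)
              (by positivity)
        _ = 3 / K ^ 20 := by field_simp
    -- term 2: `|ε a b| ≤ 5ε²`
    have h2 : |ε * X s 0 * X s 1| ≤ 5 * ε ^ 2 := by
      rw [abs_mul, abs_mul, abs_of_pos hε]
      calc ε * |X s 0| * |X s 1| ≤ ε * 1 * (5 * ε) :=
            mul_le_mul (mul_le_mul_of_nonneg_left ha hε.le) hb (abs_nonneg _) (by positivity)
        _ = 5 * ε ^ 2 := by ring
    -- term 3: `|μ a c| ≤ ε²/2`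
    have h3 : |ε ^ 2 * exp (-K ^ 10) * X s 0 * X s 2| ≤ ε ^ 2 / 2 := by
      rw [abs_mul, abs_mul, abs_mul, abs_of_pos (pow_pos hε 2), abs_of_pos (exp_pos _)]
      calc ε ^ 2 * exp (-K ^ 10) * |X s 0| * |X s 2| ≤ ε ^ 2 * (1 / 2) * 1 * 1 :=
            mul_le_mul (mul_le_mul (mul_le_mul_of_nonneg_left hek2 (by positivity)) ha
              (abs_nonneg _) (by positivity)) hc1 (abs_nonneg _) (by positivity)
        _ = ε ^ 2 / 2 := by ring
    calc |(-((ε ^ 2)⁻¹ * X s 2 * X s 3) - ε * X s 0 * X s 1 - ε ^ 2 * exp (-K ^ 10) * X s 0 * X s 2)|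
        ≤ |(-((ε ^ 2)⁻¹ * X s 2 * X s 3) - ε * X s 0 * X s 1)|
          + |ε ^ 2 * exp (-K ^ 10) * X s 0 * X s 2| := abs_sub _ _
      _ ≤ |(-((ε ^ 2)⁻¹ * X s 2 * X s 3))| + |ε * X s 0 * X s 1|
          + |ε ^ 2 * exp (-K ^ 10) * X s 0 * X s 2| := by
          have := abs_sub (-((ε ^ 2)⁻¹ * X s 2 * X s 3)) (ε * X s 0 * X s 1)
          linarith
      _ ≤ 3 / K ^ 20 + 5 * ε ^ 2 + ε ^ 2 / 2 := by rw [abs_neg]; linarith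
      _ = 3 / K ^ 20 + 11 * ε ^ 2 / 2 := by ring
  have := abs_sub_le_of_abs_deriv_le (fun s _ => hasDerivAt_a hX s) hM ht
  rw [sub_zero] at this
  have ha0 : |X 0 0 - 1| ≤ κ := init_a_near h0
  have ht2 : t ≤ 2 := ht.2.trans hτ2
  calc |X t 0 - 1| ≤ |X t 0 - X 0 0| + |X 0 0 - 1| := abs_sub_le _ _ _
    _ ≤ (3 / K ^ 20 + 11 * ε ^ 2 / 2) * t + κ := add_le_add this ha0
    _ ≤ (3 / K ^ 20 + 11 * ε ^ 2 / 2) * 2 + ε ^ 2 / 2 :=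
        add_le_add (mul_le_mul_of_nonneg_left ht2 (by positivity)) h0.le_half_sq
    _ = 6 / K ^ 20 + 2 * (6 * ε ^ 2) - ε ^ 2 / 2 := by ring
    _ ≤ 6 / K ^ 20 + 2 * (1 / K ^ 20) := by nlinarith [sq_nonneg ε]
    _ = 8 / K ^ 20 := by ring

/-- (bogo-2): `|b - εt| ≤ 17εt·K⁻²⁰` on `[0,τ]` (from `∂ₜb = ε + O(K⁻²⁰ε) + O(K⁻¹⁰ε³)`).
[cite: Tao2016AveragedNS, §5.5 (bogo-2)] -/
theorem b_linear (hX : ∀ t, HasDerivAt X (delayCircuit K ε (X t)) t) (h0 : IsKicked K ε κ X)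
    (hε : 0 < ε) (hε1 : ε ≤ 1) (hK : 1 ≤ K) (hτ2 : τ ≤ 2)
    (hεK : ε ^ 2 ≤ 1 / (6 * K ^ 20))
    (hcτ : ∀ t, 0 ≤ t → t ≤ τ → X t 2 ≤ ε ^ 2 / K ^ 10)
    {t : ℝ} (ht : t ∈ Icc 0 τ) : |X t 1 - ε * t| ≤ 17 * ε / K ^ 20 * t := by
  have hK0 : 0 < K := by linarith
  have hM : ∀ s ∈ Icc 0 τ,
      |ε * X s 0 ^ 2 - ε⁻¹ * K ^ 10 * X s 2 ^ 2 - ε * 1| ≤ 17 * ε / K ^ 20 := by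
    intro s hs
    have hc0 : 0 ≤ X s 2 := c_nonneg hX h0 hs.1
    have hcθ : X s 2 ≤ ε ^ 2 / K ^ 10 := hcτ s hs.1 hs.2
    have ha1 : |X s 0 - 1| ≤ 8 / K ^ 20 := a_near_one hX h0 hε hε1 hK hτ2 hεK hcτ hs
    have ha : |X s 0| ≤ 1 := traj_abs_le_one hX h0 s 0
    -- `|ε (a² - 1)| ≤ 16 ε K⁻²⁰`
    have h1 : |ε * (X s 0 ^ 2 - 1)| ≤ 16 * ε / K ^ 20 := by
      rw [abs_mul, abs_of_pos hε, show X s 0 ^ 2 - 1 = (X s 0 - 1) * (X s 0 + 1) by ring, abs_mul]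
      have hp1 : |X s 0 + 1| ≤ 2 := by
        calc |X s 0 + 1| ≤ |X s 0| + |1| := abs_add_le _ _
          _ ≤ 1 + 1 := by rw [abs_one]; linarith
          _ = 2 := by norm_num
      calc ε * (|X s 0 - 1| * |X s 0 + 1|) ≤ ε * (8 / K ^ 20 * 2) :=
            mul_le_mul_of_nonneg_left (mul_le_mul ha1 hp1 (abs_nonneg _) (by positivity)) hε.le
        _ = 16 * ε / K ^ 20 := by ring
    -- `0 ≤ ν c² ≤ ε³ K⁻¹⁰ ≤ ε K⁻²⁰`
    have h2 : 0 ≤ ε⁻¹ * K ^ 10 * X s 2 ^ 2 := by positivity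
    have h3 : ε⁻¹ * K ^ 10 * X s 2 ^ 2 ≤ ε / K ^ 20 := by
      have hc2 : X s 2 ^ 2 ≤ (ε ^ 2 / K ^ 10) ^ 2 := pow_le_pow_left₀ hc0 hcθ 2
      have hε2 : ε ^ 2 ≤ 1 / K ^ 10 := by
        calc ε ^ 2 ≤ 1 / (6 * K ^ 20) := hεK
          _ ≤ 1 / K ^ 10 := by
              apply one_div_le_one_div_of_le (by positivity)
              have : K ^ 10 ≤ K ^ 20 := pow_le_pow_right₀ hK (by norm_num)
              nlinarith
      calc ε⁻¹ * K ^ 10 * X s 2 ^ 2 ≤ ε⁻¹ * K ^ 10 * (ε ^ 2 / K ^ 10) ^ 2 :=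
            mul_le_mul_of_nonneg_left hc2 (by positivity)
        _ = ε * ε ^ 2 / K ^ 10 := by field_simp
        _ ≤ ε * (1 / K ^ 10) / K ^ 10 := by
            exact div_le_div_of_nonneg_right (mul_le_mul_of_nonneg_left hε2 hε.le) (by positivity)
        _ = ε / K ^ 20 := by field_simp
    rw [show ε * X s 0 ^ 2 - ε⁻¹ * K ^ 10 * X s 2 ^ 2 - ε * 1
        = ε * (X s 0 ^ 2 - 1) - ε⁻¹ * K ^ 10 * X s 2 ^ 2 by ring]
    calc |ε * (X s 0 ^ 2 - 1) - ε⁻¹ * K ^ 10 * X s 2 ^ 2|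
        ≤ |ε * (X s 0 ^ 2 - 1)| + |ε⁻¹ * K ^ 10 * X s 2 ^ 2| := abs_sub _ _
      _ ≤ 16 * ε / K ^ 20 + ε / K ^ 20 := by rw [abs_of_nonneg h2]; linarith
      _ = 17 * ε / K ^ 20 := by ring
  have hder : ∀ s ∈ Icc 0 τ, HasDerivAt (fun r => X r 1 - ε * r)
      (ε * X s 0 ^ 2 - ε⁻¹ * K ^ 10 * X s 2 ^ 2 - ε * 1) s := fun s _ =>
    (hasDerivAt_b hX s).sub ((hasDerivAt_id s).const_mul ε)
  have := abs_sub_le_of_abs_deriv_le hder hM ht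
  simpa [init_b h0] using this

/-- Sharp super-solution for `c` on `[0,τ]`, kicked: `c(t) ≤ (κe^{K¹⁰} + 2ε²) exp(K¹⁰t²/2 + 1 - K¹⁰)`
(integrating factor `exp(-(K¹⁰t²/2 + βt))`, `β = 34K⁻¹⁰`). [cite: Tao2016AveragedNS, §5.5 proof of (tcable)] -/
theorem c_upper_sharp (hX : ∀ t, HasDerivAt X (delayCircuit K ε (X t)) t) (h0 : IsKicked K ε κ X)
    (hε : 0 < ε) (hε1 : ε ≤ 1) (hK : 2 ≤ K) (hτ2 : τ ≤ 2)
    (hεK : ε ^ 2 ≤ 1 / (6 * K ^ 20))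
    (hcτ : ∀ t, 0 ≤ t → t ≤ τ → X t 2 ≤ ε ^ 2 / K ^ 10)
    {t : ℝ} (ht : t ∈ Icc 0 τ) :
    X t 2 ≤ (κ * exp (K ^ 10) + 2 * ε ^ 2) * exp (K ^ 10 * t ^ 2 / 2 + 1 - K ^ 10) := by
  have hK0 : 0 < K := by linarith
  have hκ0 : 0 ≤ κ := h0.nonneg
  have hK1 : 1 ≤ K := by linarith
  set k : ℝ := K ^ 10 with hk
  have hk0 : 0 < k := by positivity
  have hk68 : 68 ≤ k := by
    have : (2 : ℝ) ^ 10 ≤ K ^ 10 := pow_le_pow_left₀ (by norm_num) hK 10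
    simp only [hk]; nlinarith
  set β : ℝ := 34 / k with hβ
  have hβ0 : 0 ≤ β := by positivity
  have hβ1 : β ≤ 1 / 2 := by
    simp only [hβ]; rw [div_le_div_iff₀ hk0 (by norm_num)]; linarith
  set μ : ℝ := ε ^ 2 * exp (-k) with hμ
  have hμ0 : 0 ≤ μ := by positivity
  -- integrating factor `G(s) = k s²/2 + β s`
  have hG : ∀ s, HasDerivAt (fun r : ℝ => k / 2 * (r * r) + β * r) (k * s + β) s := by
    intro s
    have := (((hasDerivAt_id s).mul (hasDerivAt_id s)).const_mul (k / 2)).add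
      ((hasDerivAt_id s).const_mul β)
    exact this.congr_deriv (by simp; ring)
  have hanti := antitoneOn_intFactor (s := Icc 0 τ) (g := fun s => k * s + β)
    (G := fun r => k / 2 * (r * r) + β * r) (φ := fun _ => μ) (Φ := fun s => μ * s)
    (convex_Icc 0 τ) (fun s _ => hasDerivAt_c hX s) (fun s _ => hG s)
    (fun s _ => ((hasDerivAt_id s).const_mul μ).congr_deriv (by simp))
    (fun s hs => by
      have hc0 : 0 ≤ X s 2 := c_nonneg hX h0 hs.1
      have ha : X s 0 ^ 2 ≤ 1 := traj_sq_le_one hX h0 s 0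
      have hb : |X s 1 - ε * s| ≤ 17 * ε / K ^ 20 * s :=
        b_linear hX h0 hε hε1 hK1 hτ2 hεK hcτ hs
      have hs2 : s ≤ 2 := hs.2.trans hτ2
      -- `ν b ≤ k s + β`
      have hνb : ε⁻¹ * K ^ 10 * X s 1 ≤ k * s + β := by
        have hb' : X s 1 ≤ ε * s + 17 * ε / K ^ 20 * s := by
          have := (abs_le.1 hb).2; linarith
        have h34 : 17 * ε / K ^ 20 * s ≤ 34 * ε / K ^ 20 := by
          have h2s : 17 * ε / K ^ 20 * s ≤ 17 * ε / K ^ 20 * 2 :=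
            mul_le_mul_of_nonneg_left hs2 (by positivity)
          have h2e : 17 * ε / K ^ 20 * 2 = 34 * ε / K ^ 20 := by ring
          linarith
        calc ε⁻¹ * K ^ 10 * X s 1 ≤ ε⁻¹ * K ^ 10 * (ε * s + 34 * ε / K ^ 20) :=
              mul_le_mul_of_nonneg_left (by linarith) (by positivity)
          _ = k * s + β := by
              simp only [hβ, hk]; field_simp
      have hexp : exp (-(k / 2 * (s * s) + β * s)) ≤ 1 := by
        rw [exp_le_one_iff, neg_nonpos]; have := hs.1; positivity
      have hbr : ε ^ 2 * exp (-K ^ 10) * X s 0 ^ 2 + ε⁻¹ * K ^ 10 * X s 1 * X s 2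
          - (k * s + β) * X s 2 ≤ μ := by
        have h1 : ε ^ 2 * exp (-K ^ 10) * X s 0 ^ 2 ≤ μ := by
          simpa [hμ, hk] using mul_le_mul_of_nonneg_left ha
            (by positivity : 0 ≤ ε ^ 2 * exp (-K ^ 10))
        have h2 : ε⁻¹ * K ^ 10 * X s 1 * X s 2 ≤ (k * s + β) * X s 2 :=
          mul_le_mul_of_nonneg_right hνb hc0
        linarith
      calc (ε ^ 2 * exp (-K ^ 10) * X s 0 ^ 2 + ε⁻¹ * K ^ 10 * X s 1 * X s 2
            - (k * s + β) * X s 2) * exp (-(k / 2 * (s * s) + β * s))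
          ≤ μ * exp (-(k / 2 * (s * s) + β * s)) :=
            mul_le_mul_of_nonneg_right hbr (exp_pos _).le
        _ ≤ μ * 1 := mul_le_mul_of_nonneg_left hexp hμ0
        _ = μ := mul_one _)
  have h0mem : (0 : ℝ) ∈ Icc (0 : ℝ) τ := ⟨le_rfl, ht.1.trans ht.2⟩
  have h := hanti h0mem ht ht.1
  simp only [init_c h0, mul_zero, sub_zero, add_zero, neg_zero, exp_zero, mul_one] at h
  have h' : X t 2 * exp (-(k / 2 * (t * t) + β * t)) ≤ κ + μ * t := by linarith
  have ht2 : t ≤ 2 := ht.2.trans hτ2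
  have hE : X t 2 = X t 2 * exp (-(k / 2 * (t * t) + β * t)) * exp (k / 2 * (t * t) + β * t) := by
    rw [mul_assoc, ← exp_add, neg_add_cancel, exp_zero, mul_one]
  rw [hE]
  have hee : exp (K ^ 10) * exp (-K ^ 10) = 1 := by rw [← exp_add, add_neg_cancel, exp_zero]
  calc X t 2 * exp (-(k / 2 * (t * t) + β * t)) * exp (k / 2 * (t * t) + β * t)
      ≤ (κ + μ * t) * exp (k / 2 * (t * t) + β * t) := mul_le_mul_of_nonneg_right h' (exp_pos _).le
    _ ≤ (κ + μ * 2) * exp (k / 2 * (t * t) + 1) := by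
        have hβt : β * t ≤ 1 := by nlinarith
        have hμt : μ * t ≤ μ * 2 := mul_le_mul_of_nonneg_left ht2 hμ0
        exact mul_le_mul (by linarith) (exp_le_exp.2 (by linarith))
          (exp_pos _).le (add_nonneg hκ0 (by positivity))
    _ = (κ * exp (K ^ 10) + 2 * ε ^ 2) * exp (K ^ 10 * t ^ 2 / 2 + 1 - K ^ 10) := by
        simp only [hμ, hk]
        rw [show K ^ 10 * t ^ 2 / 2 + 1 - K ^ 10 = -K ^ 10 + (K ^ 10 / 2 * (t * t) + 1) by ring,
          exp_add (-K ^ 10)]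
        linear_combination (-(κ * exp (K ^ 10 / 2 * (t * t) + 1))) * hee

/-- Sharp sub-solution for `c` on `[K⁻⁵, τ]` (needs `K⁻⁵ ≤ τ`; the kick `κ ≥ 0` only helps):
`c(t) ≥ (ε²/(4K⁵)) exp(K¹⁰t²/2 - 1 - K¹⁰)` (integrating factor `exp(-(K¹⁰t²/2 - βt))`, first on
`[0,K⁻⁵]` where it is `≥ e^{-1/2}`, then on `[K⁻⁵,τ]`). [cite: Tao2016AveragedNS, §5.5 proof of (tcable)] -/
theorem c_lower_sharp (hX : ∀ t, HasDerivAt X (delayCircuit K ε (X t)) t) (h0 : IsKicked K ε κ X)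
    (hε : 0 < ε) (hε1 : ε ≤ 1) (hK : 2 ≤ K) (hτ2 : τ ≤ 2) (hτ5 : (K ^ 5)⁻¹ ≤ τ)
    (hεK : ε ^ 2 ≤ 1 / (6 * K ^ 20))
    (hcτ : ∀ t, 0 ≤ t → t ≤ τ → X t 2 ≤ ε ^ 2 / K ^ 10)
    {t : ℝ} (ht : t ∈ Icc (K ^ 5)⁻¹ τ) :
    ε ^ 2 / (4 * K ^ 5) * exp (K ^ 10 * t ^ 2 / 2 - 1 - K ^ 10) ≤ X t 2 := by
  have hK0 : 0 < K := by linarith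
  have hK1 : 1 ≤ K := by linarith
  set k : ℝ := K ^ 10 with hk
  have hk0 : 0 < k := by positivity
  have hk68 : 68 ≤ k := by
    have : (2 : ℝ) ^ 10 ≤ K ^ 10 := pow_le_pow_left₀ (by norm_num) hK 10
    simp only [hk]; nlinarith
  set β : ℝ := 34 / k with hβ
  have hβ0 : 0 ≤ β := by positivity
  have hβ1 : β ≤ 1 / 2 := by
    simp only [hβ]; rw [div_le_div_iff₀ hk0 (by norm_num)]; linarith
  set μ : ℝ := ε ^ 2 * exp (-k) with hμ
  have hμ0 : 0 ≤ μ := by positivity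
  set s₀ : ℝ := (K ^ 5)⁻¹ with hs₀
  have hs₀0 : 0 < s₀ := by positivity
  have hks₀ : k * (s₀ * s₀) = 1 := by simp only [hk, hs₀]; field_simp
  -- integrating factor `G(s) = k s²/2 - β s`
  have hG : ∀ s, HasDerivAt (fun r : ℝ => k / 2 * (r * r) - β * r) (k * s - β) s := by
    intro s
    have := (((hasDerivAt_id s).mul (hasDerivAt_id s)).const_mul (k / 2)).sub
      ((hasDerivAt_id s).const_mul β)
    exact this.congr_deriv (by simp; ring)
  -- the bracket `(c' - (ks-β)c) e^{-G} ≥ (μ/2) e^{-G}` on `[0,τ]`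
  have hbr : ∀ s ∈ Icc 0 τ, μ / 2 * exp (-(k / 2 * (s * s) - β * s)) ≤
      (ε ^ 2 * exp (-K ^ 10) * X s 0 ^ 2 + ε⁻¹ * K ^ 10 * X s 1 * X s 2
        - (k * s - β) * X s 2) * exp (-(k / 2 * (s * s) - β * s)) := by
    intro s hs
    have hc0 : 0 ≤ X s 2 := c_nonneg hX h0 hs.1
    have ha1 : |X s 0 - 1| ≤ 8 / K ^ 20 := a_near_one hX h0 hε hε1 hK1 hτ2 hεK hcτ hs
    have hb : |X s 1 - ε * s| ≤ 17 * ε / K ^ 20 * s :=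
      b_linear hX h0 hε hε1 hK1 hτ2 hεK hcτ hs
    have hs2 : s ≤ 2 := hs.2.trans hτ2
    -- `a² ≥ 1/2`
    have hK20 : 8 / K ^ 20 ≤ 1 / 4 := by
      rw [div_le_div_iff₀ (by positivity) (by norm_num)]
      have : (2 : ℝ) ^ 20 ≤ K ^ 20 := pow_le_pow_left₀ (by norm_num) hK 20
      nlinarith
    have ha_lo : 3 / 4 ≤ X s 0 := by have := (abs_le.1 ha1).1; linarith
    have ha2 : 1 / 2 ≤ X s 0 ^ 2 := by nlinarith
    -- `ν b ≥ k s - β`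
    have hνb : k * s - β ≤ ε⁻¹ * K ^ 10 * X s 1 := by
      have hb' : ε * s - 17 * ε / K ^ 20 * s ≤ X s 1 := by
        have := (abs_le.1 hb).1; linarith
      have h34 : 17 * ε / K ^ 20 * s ≤ 34 * ε / K ^ 20 := by
        have h2s : 17 * ε / K ^ 20 * s ≤ 17 * ε / K ^ 20 * 2 :=
          mul_le_mul_of_nonneg_left hs2 (by positivity)
        have h2e : 17 * ε / K ^ 20 * 2 = 34 * ε / K ^ 20 := by ring
        linarith
      calc k * s - β = ε⁻¹ * K ^ 10 * (ε * s - 34 * ε / K ^ 20) := by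
            simp only [hβ, hk]; field_simp
        _ ≤ ε⁻¹ * K ^ 10 * X s 1 :=
            mul_le_mul_of_nonneg_left (by linarith) (by positivity)
    have h1 : μ / 2 ≤ ε ^ 2 * exp (-K ^ 10) * X s 0 ^ 2 := by
      have : ε ^ 2 * exp (-K ^ 10) * (1 / 2) ≤ ε ^ 2 * exp (-K ^ 10) * X s 0 ^ 2 :=
        mul_le_mul_of_nonneg_left ha2 (by positivity)
      simp only [hμ, hk] at this ⊢; linarith
    have h2 : (k * s - β) * X s 2 ≤ ε⁻¹ * K ^ 10 * X s 1 * X s 2 :=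
      mul_le_mul_of_nonneg_right hνb hc0
    have hbr' : μ / 2 ≤ ε ^ 2 * exp (-K ^ 10) * X s 0 ^ 2 + ε⁻¹ * K ^ 10 * X s 1 * X s 2
        - (k * s - β) * X s 2 := by linarith
    exact mul_le_mul_of_nonneg_right hbr' (exp_pos _).le
  -- Stage A: on `[0, s₀]`, `e^{-G} ≥ 1/2`, so `c e^{-G} - (μ/4) s` is monotone
  have hs₀τ : s₀ ≤ τ := hτ5
  have hmonoA := monotoneOn_intFactor (s := Icc 0 s₀) (g := fun s => k * s - β)
    (G := fun r => k / 2 * (r * r) - β * r) (φ := fun _ => μ / 4) (Φ := fun s => μ / 4 * s)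
    (convex_Icc 0 s₀) (fun s _ => hasDerivAt_c hX s) (fun s _ => hG s)
    (fun s _ => ((hasDerivAt_id s).const_mul (μ / 4)).congr_deriv (by simp))
    (fun s hs => by
      have hsτ : s ∈ Icc 0 τ := ⟨hs.1, hs.2.trans hs₀τ⟩
      have hexp : 1 / 2 ≤ exp (-(k / 2 * (s * s) - β * s)) := by
        have hss : k * (s * s) ≤ 1 := by
          calc k * (s * s) ≤ k * (s₀ * s₀) := by
                exact mul_le_mul_of_nonneg_left (mul_self_le_mul_self hs.1 hs.2) hk0.le
            _ = 1 := hks₀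
        have harg : -(1 / 2 : ℝ) ≤ -(k / 2 * (s * s) - β * s) := by
          have : 0 ≤ β * s := mul_nonneg hβ0 hs.1
          linarith
        calc (1 / 2 : ℝ) ≤ exp (-(1 / 2 : ℝ)) := by
              have h := Real.add_one_le_exp (-(1 / 2 : ℝ))
              linarith
          _ ≤ exp (-(k / 2 * (s * s) - β * s)) := exp_le_exp.2 harg
      calc μ / 4 = μ / 2 * (1 / 2) := by ring
        _ ≤ μ / 2 * exp (-(k / 2 * (s * s) - β * s)) :=
            mul_le_mul_of_nonneg_left hexp (by positivity)
        _ ≤ _ := hbr s hsτ)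
  have hA := hmonoA (⟨le_rfl, hs₀0.le⟩ : (0 : ℝ) ∈ Icc 0 s₀) ⟨hs₀0.le, le_rfl⟩ hs₀0.le
  simp only [init_c h0, mul_zero, sub_zero, neg_zero, exp_zero, mul_one] at hA
  have hκ0 : 0 ≤ κ := h0.nonneg
  -- Stage B: on `[s₀, τ]`, `c e^{-G}` is monotone
  have hmonoB := monotoneOn_intFactor (s := Icc s₀ τ) (g := fun s => k * s - β)
    (G := fun r => k / 2 * (r * r) - β * r) (φ := fun _ => 0) (Φ := fun _ => 0)
    (convex_Icc s₀ τ) (fun s _ => hasDerivAt_c hX s) (fun s _ => hG s)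
    (fun s _ => hasDerivAt_const s (0 : ℝ))
    (fun s hs => by
      have hsτ : s ∈ Icc 0 τ := ⟨hs₀0.le.trans hs.1, hs.2⟩
      exact le_trans (by positivity) (hbr s hsτ))
  have hB := hmonoB (⟨le_rfl, hs₀τ⟩ : s₀ ∈ Icc s₀ τ) ht ht.1
  simp only [sub_zero] at hB
  -- combine: `c t e^{-G t} ≥ μ/4 s₀`
  have hct : μ / 4 * s₀ ≤ X t 2 * exp (-(k / 2 * (t * t) - β * t)) := by linarith
  have ht0 : 0 ≤ t := hs₀0.le.trans ht.1
  have ht2 : t ≤ 2 := ht.2.trans hτ2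
  have hE : X t 2 = X t 2 * exp (-(k / 2 * (t * t) - β * t)) * exp (k / 2 * (t * t) - β * t) := by
    rw [mul_assoc, ← exp_add, neg_add_cancel, exp_zero, mul_one]
  rw [hE]
  calc ε ^ 2 / (4 * K ^ 5) * exp (K ^ 10 * t ^ 2 / 2 - 1 - K ^ 10)
      = μ / 4 * s₀ * exp (k / 2 * (t * t) - 1) := by
        simp only [hμ, hk, hs₀]
        rw [show K ^ 10 * t ^ 2 / 2 - 1 - K ^ 10 = -K ^ 10 + (K ^ 10 / 2 * (t * t) - 1) by ring,
          exp_add (-K ^ 10)]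
        field_simp
    _ ≤ μ / 4 * s₀ * exp (k / 2 * (t * t) - β * t) := by
        have hβt : β * t ≤ 1 := by nlinarith
        exact mul_le_mul_of_nonneg_left (exp_le_exp.2 (by linarith)) (by positivity)
    _ ≤ X t 2 * exp (-(k / 2 * (t * t) - β * t)) * exp (k / 2 * (t * t) - β * t) :=
        mul_le_mul_of_nonneg_right hct (exp_pos _).le

end PhaseOne

section CriticalTime

variable {K ε κ τ : ℝ} {X : ℝ → Fin 5 → ℝ}

/-- **(tcable) and (c-bound), kicked datum.** If `τ` is the first hitting time of the level `K⁻¹⁰ε²`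
by `c` on `[0,2]`, then `√2 - 1/√K ≤ τ ≤ √2 + 1/√K` (in particular `1 ≤ τ < 7/4`) and
`c(τ) = K⁻¹⁰ε²` — the SAME window as for the designed datum (this is where `κ ≤ kickTolerance` is
spent). [cite: Tao2016AveragedNS, §5.5 (tcable), (c-bound)] -/
theorem tc_window (hX : ∀ t, HasDerivAt X (delayCircuit K ε (X t)) t) (h0 : IsKicked K ε κ X)
    (hε : 0 < ε) (hε1 : ε ≤ 1) (hK : 16 ≤ K) (hεK : ε ^ 2 ≤ 1 / (6 * K ^ 20))
    (hτ0 : 0 < τ) (hτ2 : τ ≤ 2)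
    (hcτ : ∀ t, 0 ≤ t → t ≤ τ → X t 2 ≤ ε ^ 2 / K ^ 10)
    (hτeq : τ < 2 → X τ 2 = ε ^ 2 / K ^ 10) :
    sqrt 2 - (sqrt K)⁻¹ ≤ τ ∧ τ ≤ sqrt 2 + (sqrt K)⁻¹ ∧ 1 ≤ τ ∧ τ < 7 / 4 ∧
      X τ 2 = ε ^ 2 / K ^ 10 := by
  obtain ⟨hs0, hs4, hKs, h4, hKs2⟩ := invSqrt_facts hK
  have hK2 : 2 ≤ K := by linarith
  have hK0 : 0 < K := by linarith
  have h72 := sqrt_two_gt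
  have h71 := sqrt_two_lt
  -- early side
  have hearly : sqrt 2 - (sqrt K)⁻¹ ≤ τ := by
    by_contra hlt'
    have hlt := not_le.1 hlt'
    have hτlt2 : τ < 2 := by linarith
    have hcτeq := hτeq hτlt2
    have hup := c_upper_sharp hX h0 hε hε1 hK2 hτ2 hεK hcτ (t := τ) ⟨hτ0.le, le_rfl⟩
    have hbd := early_bound (ε := ε) hK hτ0.le hlt.le h0.le_tol
    have hnum := numeric_early3 hK2
    have : X τ 2 < ε ^ 2 / K ^ 10 :=
      calc X τ 2 ≤ (κ * exp (K ^ 10) + 2 * ε ^ 2) * exp (K ^ 10 * τ ^ 2 / 2 + 1 - K ^ 10) := hup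
        _ ≤ 3 * ε ^ 2 * exp (1 - K ^ 9) := hbd
        _ = ε ^ 2 * (3 * exp (1 - K ^ 9)) := by ring
        _ < ε ^ 2 * (1 / K ^ 10) := mul_lt_mul_of_pos_left hnum (by positivity)
        _ = ε ^ 2 / K ^ 10 := by ring
    exact absurd hcτeq this.ne
  have hτ1 : 1 ≤ τ := by linarith
  -- late side
  have hlate : τ ≤ sqrt 2 + (sqrt K)⁻¹ := by
    by_contra hlt'
    have hlt := not_le.1 hlt'
    set T := sqrt 2 + (sqrt K)⁻¹ with hT
    have hT5 : (K ^ 5)⁻¹ ≤ T := by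
      have : (K ^ 5)⁻¹ ≤ 1 := inv_le_one_of_one_le₀ (one_le_pow₀ (by linarith))
      linarith
    have hτ5 : (K ^ 5)⁻¹ ≤ τ := by linarith
    have hlow := c_lower_sharp hX h0 hε hε1 hK2 hτ2 hτ5 hεK hcτ (t := T) ⟨hT5, hlt.le⟩
    have hcT : X T 2 ≤ ε ^ 2 / K ^ 10 := hcτ T (by linarith) hlt.le
    have hexpo := exponent_late hK
    have hnum := numeric_late hK2
    have : ε ^ 2 / K ^ 10 < X T 2 :=
      calc ε ^ 2 / K ^ 10 = ε ^ 2 * (1 / K ^ 10) := by ring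
        _ < ε ^ 2 * (1 / (4 * K ^ 5) * exp (K ^ 9 - 1)) := mul_lt_mul_of_pos_left hnum (by positivity)
        _ = ε ^ 2 / (4 * K ^ 5) * exp (K ^ 9 - 1) := by ring
        _ ≤ ε ^ 2 / (4 * K ^ 5) * exp (K ^ 10 * T ^ 2 / 2 - 1 - K ^ 10) :=
            mul_le_mul_of_nonneg_left (exp_le_exp.2 hexpo) (by positivity)
        _ ≤ X T 2 := hlow
    exact absurd hcT (not_le.2 this)
  have hτ74 : τ < 7 / 4 := by linarith
  exact ⟨hearly, hlate, hτ1, hτ74, hτeq (by linarith)⟩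

end CriticalTime

section PhaseTwo

/-! ## After the critical time: `b ≳ ε`, (c-large), (cgrow-2) -/

variable {K ε κ τ : ℝ} {X : ℝ → Fin 5 → ℝ}

/-- `b ≥ ε/8` on `[τ,2]` ("`b(t) ≳ ε` for `t ∈ [t_c,2]`", from (bogo-2) at `t_c` and
`∂ₜb ≥ -ε³exp(O(K¹⁰))`; for the kicked datum `c ≤ 3ε²e^{10K¹⁰}` on `[t_c,2]`).
[cite: Tao2016AveragedNS, §5.5 proof] -/
theorem b_lower_after (hX : ∀ t, HasDerivAt X (delayCircuit K ε (X t)) t) (h0 : IsKicked K ε κ X)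
    (hε : 0 < ε) (hε1 : ε ≤ 1) (hK : 16 ≤ K) (hεK : ε ^ 2 ≤ 1 / (6 * K ^ 20))
    (hεexp : ε ^ 2 ≤ exp (-(20 * K ^ 10)) / (144 * K ^ 10))
    (hτ1 : 1 ≤ τ) (hτ2 : τ ≤ 2)
    (hcτ : ∀ t, 0 ≤ t → t ≤ τ → X t 2 ≤ ε ^ 2 / K ^ 10)
    {t : ℝ} (ht : t ∈ Icc τ 2) : ε / 8 ≤ X t 1 := by
  have hK0 : 0 < K := by linarith
  have hK1 : 1 ≤ K := by linarith
  set k : ℝ := K ^ 10 with hk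
  have hk0 : 0 < k := by positivity
  -- `b(τ) ≥ ε/2`
  have hbτ : ε / 2 ≤ X τ 1 := by
    have hb := b_linear hX h0 hε hε1 hK1 hτ2 hεK hcτ (t := τ) ⟨by linarith, le_rfl⟩
    have h1 := (abs_le.1 hb).1
    have hK20 : 34 / K ^ 20 ≤ 1 / 2 := by
      rw [div_le_div_iff₀ (by positivity) (by norm_num)]
      have : (2 : ℝ) ^ 20 ≤ K ^ 20 := pow_le_pow_left₀ (by norm_num) (by linarith) 20
      nlinarith
    have h2 : 17 * ε / K ^ 20 * τ ≤ 34 / K ^ 20 * ε := by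
      have : 17 * ε / K ^ 20 * τ ≤ 17 * ε / K ^ 20 * 2 :=
        mul_le_mul_of_nonneg_left hτ2 (by positivity)
      have h2e : 17 * ε / K ^ 20 * 2 = 34 / K ^ 20 * ε := by ring
      linarith
    have h3 : 34 / K ^ 20 * ε ≤ 1 / 2 * ε := mul_le_mul_of_nonneg_right hK20 hε.le
    nlinarith
  -- `∂ₜb ≥ -ε/16` on `[τ,2]`
  have hmono := monotoneOn_sub_of_le_deriv (φ := fun _ => -(ε / 16))
    (Φ := fun s => -(ε / 16) * s) (convex_Icc τ 2) (fun s _ => hasDerivAt_b hX s)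
    (fun s _ => ((hasDerivAt_id s).const_mul (-(ε / 16))).congr_deriv (by simp))
    (fun s hs => by
      have hs02 : s ∈ Icc (0 : ℝ) 2 := ⟨by linarith [hs.1], hs.2⟩
      have hc0 : 0 ≤ X s 2 := c_nonneg hX h0 hs02.1
      have hcc := c_crude hX h0 hε hε1 hs02
      -- the tolerance: `κe^{k} ≤ ε²e^{K⁹√K/4} ≤ ε²e^{k}`, so `κe^{k} + 2ε² ≤ 3ε²e^{k}`
      have hlam : κ * exp (K ^ 10) + 2 * ε ^ 2 ≤ 3 * ε ^ 2 * exp k := by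
        have h94 : K ^ 9 * sqrt K / 4 ≤ k := by
          have := pow9_sqrt_le hK1; have : 0 ≤ K ^ 9 * sqrt K := by positivity
          simp only [hk]; linarith
        have h1 : κ * exp (K ^ 10) ≤ ε ^ 2 * exp k :=
          h0.le_tol.trans (mul_le_mul_of_nonneg_left (exp_le_exp.2 h94) (sq_nonneg ε))
        have h2 : (1 : ℝ) ≤ exp k := by
          have := Real.add_one_le_exp k; linarith [hk0.le]
        nlinarith [sq_nonneg ε]
      have hc9 : X s 2 ≤ 3 * ε ^ 2 * exp (10 * k) := by
        calc X s 2 ≤ (κ * exp (K ^ 10) + 2 * ε ^ 2) * exp ((5 * s - 1) * K ^ 10) := hcc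
          _ ≤ (3 * ε ^ 2 * exp k) * exp (9 * k) :=
              mul_le_mul hlam (exp_le_exp.2 (by simp only [hk]; nlinarith [hs.2])) (exp_pos _).le
                (by positivity)
          _ = 3 * ε ^ 2 * exp (10 * k) := by
              rw [show (10 : ℝ) * k = k + 9 * k by ring, exp_add (k)]; ring
      have hc2 : X s 2 ^ 2 ≤ (3 * ε ^ 2 * exp (10 * k)) ^ 2 := pow_le_pow_left₀ hc0 hc9 2
      -- `ν c² ≤ 9 k ε³ e^{20k} ≤ ε/16`
      have hνc : ε⁻¹ * K ^ 10 * X s 2 ^ 2 ≤ ε / 16 := by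
        have hε2 : ε ^ 2 * exp (20 * k) ≤ 1 / (144 * k) := by
          have := hεexp
          rw [show -(20 * K ^ 10) = -(20 * k) by simp [hk],
            show 144 * K ^ 10 = 144 * k by simp [hk]] at this
          calc ε ^ 2 * exp (20 * k) ≤ exp (-(20 * k)) / (144 * k) * exp (20 * k) :=
                mul_le_mul_of_nonneg_right this (exp_pos _).le
            _ = 1 / (144 * k) := by
                rw [div_mul_eq_mul_div, mul_comm (exp _) (exp _), ← exp_add, add_neg_cancel,
                  exp_zero]
        calc ε⁻¹ * K ^ 10 * X s 2 ^ 2 ≤ ε⁻¹ * K ^ 10 * (3 * ε ^ 2 * exp (10 * k)) ^ 2 :=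
              mul_le_mul_of_nonneg_left hc2 (by positivity)
          _ = 9 * k * ε * (ε ^ 2 * exp (20 * k)) := by
              simp only [hk]
              rw [show (20 : ℝ) * K ^ 10 = 10 * K ^ 10 + 10 * K ^ 10 by ring, exp_add]
              field_simp
              ring
          _ ≤ 9 * k * ε * (1 / (144 * k)) := mul_le_mul_of_nonneg_left hε2 (by positivity)
          _ = ε / 16 := by field_simp; ring
      have ha2 : 0 ≤ ε * X s 0 ^ 2 := by positivity
      linarith)
  have hτmem : τ ∈ Icc τ 2 := ⟨le_rfl, hτ2⟩
  have h := hmono hτmem ht ht.1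
  simp only at h
  have : t - τ ≤ 1 := by linarith [ht.2]
  nlinarith

/-- Exponential growth after `t_c`: `c(t) ≥ K⁻¹⁰ε² exp(K¹⁰(t-τ)/8)` on `[τ,2]` (from
`∂ₜc ≳ K¹⁰c`). [cite: Tao2016AveragedNS, §5.5 (c-large)] -/
theorem c_growth (hX : ∀ t, HasDerivAt X (delayCircuit K ε (X t)) t) (h0 : IsKicked K ε κ X)
    (hε : 0 < ε) (hε1 : ε ≤ 1) (hK : 16 ≤ K) (hεK : ε ^ 2 ≤ 1 / (6 * K ^ 20))
    (hεexp : ε ^ 2 ≤ exp (-(20 * K ^ 10)) / (144 * K ^ 10))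
    (hτ1 : 1 ≤ τ) (hτ2 : τ ≤ 2)
    (hcτ : ∀ t, 0 ≤ t → t ≤ τ → X t 2 ≤ ε ^ 2 / K ^ 10) (hcτeq : X τ 2 = ε ^ 2 / K ^ 10)
    {t : ℝ} (ht : t ∈ Icc τ 2) :
    ε ^ 2 / K ^ 10 * exp (K ^ 10 * (t - τ) / 8) ≤ X t 2 := by
  have hK0 : 0 < K := by linarith
  set k : ℝ := K ^ 10 with hk
  have hmono := monotoneOn_intFactor (s := Icc τ 2) (g := fun _ => k / 8)
    (G := fun s => k / 8 * s) (φ := fun _ => 0) (Φ := fun _ => 0) (convex_Icc τ 2)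
    (fun s _ => hasDerivAt_c hX s)
    (fun s _ => ((hasDerivAt_id s).const_mul (k / 8)).congr_deriv (by simp))
    (fun s _ => hasDerivAt_const s (0 : ℝ))
    (fun s hs => by
      have hc0 : 0 ≤ X s 2 := c_nonneg hX h0 (by linarith [hs.1])
      have hb : ε / 8 ≤ X s 1 := b_lower_after hX h0 hε hε1 hK hεK hεexp hτ1 hτ2 hcτ hs
      have hνb : k / 8 ≤ ε⁻¹ * K ^ 10 * X s 1 := by
        calc k / 8 = ε⁻¹ * K ^ 10 * (ε / 8) := by simp only [hk]; field_simp
          _ ≤ ε⁻¹ * K ^ 10 * X s 1 := mul_le_mul_of_nonneg_left hb (by positivity)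
      have h1 : k / 8 * X s 2 ≤ ε⁻¹ * K ^ 10 * X s 1 * X s 2 :=
        mul_le_mul_of_nonneg_right hνb hc0
      have h2 : 0 ≤ ε ^ 2 * exp (-K ^ 10) * X s 0 ^ 2 := by positivity
      have : 0 ≤ ε ^ 2 * exp (-K ^ 10) * X s 0 ^ 2 + ε⁻¹ * K ^ 10 * X s 1 * X s 2
          - k / 8 * X s 2 := by linarith
      exact mul_nonneg this (exp_pos _).le)
  have hτmem : τ ∈ Icc τ 2 := ⟨le_rfl, hτ2⟩
  have h := hmono hτmem ht ht.1
  simp only [sub_zero, hcτeq] at h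
  have hE : X t 2 = X t 2 * exp (-(k / 8 * t)) * exp (k / 8 * t) := by
    rw [mul_assoc, ← exp_add, neg_add_cancel, exp_zero, mul_one]
  rw [hE]
  calc ε ^ 2 / K ^ 10 * exp (K ^ 10 * (t - τ) / 8)
      = ε ^ 2 / K ^ 10 * exp (-(k / 8 * τ)) * exp (k / 8 * t) := by
        rw [mul_assoc, ← exp_add]; congr 2; simp only [hk]; ring
    _ ≤ X t 2 * exp (-(k / 8 * t)) * exp (k / 8 * t) :=
        mul_le_mul_of_nonneg_right h (exp_pos _).le

/-- (c-large): `c ≥ K¹⁰⁰ε²` on `I = [τ + K⁻⁹, 2]` ("the rotor gate will be continuously and strongly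
activated from time `t_c + K⁻⁹` onwards"), given `e^{K/8} ≥ K¹¹⁰`.
[cite: Tao2016AveragedNS, §5.5 (c-large)] -/
theorem c_large (hX : ∀ t, HasDerivAt X (delayCircuit K ε (X t)) t) (h0 : IsKicked K ε κ X)
    (hε : 0 < ε) (hε1 : ε ≤ 1) (hK : 16 ≤ K) (hεK : ε ^ 2 ≤ 1 / (6 * K ^ 20))
    (hεexp : ε ^ 2 ≤ exp (-(20 * K ^ 10)) / (144 * K ^ 10)) (hN3 : K ^ 110 ≤ exp (K / 8))
    (hτ1 : 1 ≤ τ) (hτ2 : τ ≤ 2)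
    (hcτ : ∀ t, 0 ≤ t → t ≤ τ → X t 2 ≤ ε ^ 2 / K ^ 10) (hcτeq : X τ 2 = ε ^ 2 / K ^ 10)
    {t : ℝ} (ht : t ∈ Icc (τ + (K ^ 9)⁻¹) 2) : K ^ 100 * ε ^ 2 ≤ X t 2 := by
  have hK0 : 0 < K := by linarith
  have ht' : t ∈ Icc τ 2 := ⟨by linarith [ht.1, inv_pos.2 (pow_pos hK0 9)], ht.2⟩
  have hg := c_growth hX h0 hε hε1 hK hεK hεexp hτ1 hτ2 hcτ hcτeq ht'
  have hexp : K / 8 ≤ K ^ 10 * (t - τ) / 8 := by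
    have h1 : (K ^ 9)⁻¹ ≤ t - τ := by linarith [ht.1]
    have : K ^ 10 * (K ^ 9)⁻¹ = K := by field_simp
    have h2 : K ^ 10 * (K ^ 9)⁻¹ ≤ K ^ 10 * (t - τ) := mul_le_mul_of_nonneg_left h1 (by positivity)
    linarith
  calc K ^ 100 * ε ^ 2 = ε ^ 2 / K ^ 10 * K ^ 110 := by field_simp
    _ ≤ ε ^ 2 / K ^ 10 * exp (K / 8) := mul_le_mul_of_nonneg_left hN3 (by positivity)
    _ ≤ ε ^ 2 / K ^ 10 * exp (K ^ 10 * (t - τ) / 8) :=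
        mul_le_mul_of_nonneg_left (exp_le_exp.2 hexp) (by positivity)
    _ ≤ X t 2 := hg

/-- (cgrow-2): on `I`, `0 ≤ ∂ₜc ≤ 6K¹⁰c`. [cite: Tao2016AveragedNS, §5.5 (cgrow-2)] -/
theorem c_deriv_bounds (hX : ∀ t, HasDerivAt X (delayCircuit K ε (X t)) t) (h0 : IsKicked K ε κ X)
    (hε : 0 < ε) (hε1 : ε ≤ 1) (hK : 16 ≤ K) (hεK : ε ^ 2 ≤ 1 / (6 * K ^ 20))
    (hεexp : ε ^ 2 ≤ exp (-(20 * K ^ 10)) / (144 * K ^ 10)) (hN3 : K ^ 110 ≤ exp (K / 8))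
    (hτ1 : 1 ≤ τ) (hτ2 : τ ≤ 2)
    (hcτ : ∀ t, 0 ≤ t → t ≤ τ → X t 2 ≤ ε ^ 2 / K ^ 10) (hcτeq : X τ 2 = ε ^ 2 / K ^ 10)
    {t : ℝ} (ht : t ∈ Icc (τ + (K ^ 9)⁻¹) 2) :
    0 ≤ ε ^ 2 * exp (-K ^ 10) * X t 0 ^ 2 + ε⁻¹ * K ^ 10 * X t 1 * X t 2 ∧
      ε ^ 2 * exp (-K ^ 10) * X t 0 ^ 2 + ε⁻¹ * K ^ 10 * X t 1 * X t 2 ≤ 6 * K ^ 10 * X t 2 := by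
  have hK0 : 0 < K := by linarith
  have ht' : t ∈ Icc τ 2 := ⟨by linarith [ht.1, inv_pos.2 (pow_pos hK0 9)], ht.2⟩
  have ht02 : t ∈ Icc (0 : ℝ) 2 := ⟨by linarith [ht'.1], ht.2⟩
  have hc0 : 0 ≤ X t 2 := c_nonneg hX h0 ht02.1
  have hcl : K ^ 100 * ε ^ 2 ≤ X t 2 := c_large hX h0 hε hε1 hK hεK hεexp hN3 hτ1 hτ2 hcτ hcτeq ht
  have hb : ε / 8 ≤ X t 1 := b_lower_after hX h0 hε hε1 hK hεK hεexp hτ1 hτ2 hcτ ht'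
  have hb5 : |X t 1| ≤ 5 * ε := (bc_small hX h0 hε hε1 ht02).1
  have ha : X t 0 ^ 2 ≤ 1 := traj_sq_le_one hX h0 t 0
  constructor
  · have h1 : 0 ≤ ε⁻¹ * K ^ 10 * X t 1 * X t 2 := by
      have : 0 ≤ X t 1 := by linarith [hε.le]
      positivity
    positivity
  · -- `μ a² ≤ ε² ≤ K¹⁰⁰ ε² ≤ c ≤ K¹⁰ c` and `ν b c ≤ 5 K¹⁰ c`
    have hek : exp (-K ^ 10) ≤ 1 := by rw [exp_le_one_iff, neg_nonpos]; positivity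
    have h1 : ε ^ 2 * exp (-K ^ 10) * X t 0 ^ 2 ≤ K ^ 10 * X t 2 := by
      calc ε ^ 2 * exp (-K ^ 10) * X t 0 ^ 2 ≤ ε ^ 2 * 1 * 1 :=
            mul_le_mul (mul_le_mul_of_nonneg_left hek (by positivity)) ha (by positivity)
              (by positivity)
        _ ≤ K ^ 100 * ε ^ 2 := by
            have : (1 : ℝ) ≤ K ^ 100 := one_le_pow₀ (by linarith)
            nlinarith [pow_pos hε 2]
        _ ≤ X t 2 := hcl
        _ ≤ K ^ 10 * X t 2 := by
            have : (1 : ℝ) ≤ K ^ 10 := one_le_pow₀ (by linarith)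
            nlinarith
    have h2 : ε⁻¹ * K ^ 10 * X t 1 * X t 2 ≤ 5 * K ^ 10 * X t 2 := by
      have hb' : X t 1 ≤ 5 * ε := (le_abs_self _).trans hb5
      have h5 : ε⁻¹ * X t 1 ≤ 5 := by rw [inv_mul_le_iff₀ hε]; linarith
      have : ε⁻¹ * K ^ 10 * X t 1 * X t 2 = (ε⁻¹ * X t 1) * (K ^ 10 * X t 2) := by ring
      rw [this]
      have hkc : 0 ≤ K ^ 10 * X t 2 := by positivity
      nlinarith
    linarith

/-! ## Equipartition: the corrector `V = a d ε²/c` and (douse) -/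

/-- Size of the remainder in `∂ₜV` on `I`: `|R| ≤ 9K⁻⁹⁰` (uses `ε²/c ≤ K⁻¹⁰⁰`, `0 ≤ ∂ₜc ≤ 6K¹⁰c`,
all modes `O(1)`). [cite: Tao2016AveragedNS, §5.5 (douse)] -/
theorem V_remainder_le (hX : ∀ t, HasDerivAt X (delayCircuit K ε (X t)) t) (h0 : IsKicked K ε κ X)
    (hε : 0 < ε) (hε1 : ε ≤ 1) (hK : 16 ≤ K) (hεK : ε ^ 2 ≤ 1 / (6 * K ^ 20))
    (hεexp : ε ^ 2 ≤ exp (-(20 * K ^ 10)) / (144 * K ^ 10)) (hN3 : K ^ 110 ≤ exp (K / 8))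
    (hτ1 : 1 ≤ τ) (hτ2 : τ ≤ 2)
    (hcτ : ∀ t, 0 ≤ t → t ≤ τ → X t 2 ≤ ε ^ 2 / K ^ 10) (hcτeq : X τ 2 = ε ^ 2 / K ^ 10)
    {t : ℝ} (ht : t ∈ Icc (τ + (K ^ 9)⁻¹) 2) :
    |(-(ε * X t 0 * X t 1 * X t 3 + ε ^ 2 * exp (-K ^ 10) * X t 0 * X t 2 * X t 3
            + K * X t 0 * X t 3 * X t 4) * (ε ^ 2 * (X t 2)⁻¹)
          - X t 0 * X t 3 * (ε ^ 2 * (X t 2)⁻¹) *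
            ((ε ^ 2 * exp (-K ^ 10) * X t 0 ^ 2 + ε⁻¹ * K ^ 10 * X t 1 * X t 2) * (X t 2)⁻¹))|
      ≤ 9 / K ^ 90 := by
  have hK0 : 0 < K := by linarith
  have hK1 : 1 ≤ K := by linarith
  have hcl : K ^ 100 * ε ^ 2 ≤ X t 2 := c_large hX h0 hε hε1 hK hεK hεexp hN3 hτ1 hτ2 hcτ hcτeq ht
  have hcpos : 0 < X t 2 := lt_of_lt_of_le (by positivity) hcl
  obtain ⟨hc'0, hc'6⟩ := c_deriv_bounds hX h0 hε hε1 hK hεK hεexp hN3 hτ1 hτ2 hcτ hcτeq ht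
  set q : ℝ := ε ^ 2 * (X t 2)⁻¹ with hq
  have hq0 : 0 ≤ q := by positivity
  have hq1 : q ≤ 1 / K ^ 100 := by
    simp only [hq]
    rw [← div_eq_mul_inv, div_le_div_iff₀ hcpos (by positivity), one_mul]
    linarith
  set c' : ℝ := ε ^ 2 * exp (-K ^ 10) * X t 0 ^ 2 + ε⁻¹ * K ^ 10 * X t 1 * X t 2 with hc'
  have hrat0 : 0 ≤ c' * (X t 2)⁻¹ := by positivity
  have hrat : c' * (X t 2)⁻¹ ≤ 6 * K ^ 10 := by
    rw [← div_eq_mul_inv, div_le_iff₀ hcpos]; exact hc'6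
  have ha : |X t 0| ≤ 1 := traj_abs_le_one hX h0 t 0
  have hb : |X t 1| ≤ 1 := traj_abs_le_one hX h0 t 1
  have hc : |X t 2| ≤ 1 := traj_abs_le_one hX h0 t 2
  have hd : |X t 3| ≤ 1 := traj_abs_le_one hX h0 t 3
  have he : |X t 4| ≤ 1 := traj_abs_le_one hX h0 t 4
  have hμ1 : ε ^ 2 * exp (-K ^ 10) ≤ 1 := by
    have hek : exp (-K ^ 10) ≤ 1 := by rw [exp_le_one_iff, neg_nonpos]; positivity
    calc ε ^ 2 * exp (-K ^ 10) ≤ 1 ^ 2 * 1 :=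
          mul_le_mul (pow_le_pow_left₀ hε.le hε1 2) hek (exp_pos _).le (by positivity)
      _ = 1 := by ring
  -- term 1
  have hT1 : |(-(ε * X t 0 * X t 1 * X t 3 + ε ^ 2 * exp (-K ^ 10) * X t 0 * X t 2 * X t 3
      + K * X t 0 * X t 3 * X t 4) * q)| ≤ (2 + K) * (1 / K ^ 100) := by
    rw [abs_mul, abs_neg, abs_of_nonneg hq0]
    have hin : |ε * X t 0 * X t 1 * X t 3 + ε ^ 2 * exp (-K ^ 10) * X t 0 * X t 2 * X t 3
        + K * X t 0 * X t 3 * X t 4| ≤ 2 + K := by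
      have e1 : |ε * X t 0 * X t 1 * X t 3| ≤ 1 := by
        rw [abs_mul, abs_mul, abs_mul, abs_of_pos hε]
        calc ε * |X t 0| * |X t 1| * |X t 3| ≤ 1 * 1 * 1 * 1 := by
              gcongr
          _ = 1 := by ring
      have e2 : |ε ^ 2 * exp (-K ^ 10) * X t 0 * X t 2 * X t 3| ≤ 1 := by
        rw [abs_mul, abs_mul, abs_mul, abs_of_nonneg (by positivity : 0 ≤ ε ^ 2 * exp (-K ^ 10))]
        calc ε ^ 2 * exp (-K ^ 10) * |X t 0| * |X t 2| * |X t 3| ≤ 1 * 1 * 1 * 1 := by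
              gcongr
          _ = 1 := by ring
      have e3 : |K * X t 0 * X t 3 * X t 4| ≤ K := by
        rw [abs_mul, abs_mul, abs_mul, abs_of_pos hK0]
        calc K * |X t 0| * |X t 3| * |X t 4| ≤ K * 1 * 1 * 1 := by gcongr
          _ = K := by ring
      calc _ ≤ |ε * X t 0 * X t 1 * X t 3 + ε ^ 2 * exp (-K ^ 10) * X t 0 * X t 2 * X t 3|
            + |K * X t 0 * X t 3 * X t 4| := abs_add_le _ _
        _ ≤ |ε * X t 0 * X t 1 * X t 3| + |ε ^ 2 * exp (-K ^ 10) * X t 0 * X t 2 * X t 3|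
            + |K * X t 0 * X t 3 * X t 4| := by
            have := abs_add_le (ε * X t 0 * X t 1 * X t 3)
              (ε ^ 2 * exp (-K ^ 10) * X t 0 * X t 2 * X t 3)
            linarith
        _ ≤ 2 + K := by linarith
    exact mul_le_mul hin hq1 hq0 (by positivity)
  -- term 2
  have hT2 : |X t 0 * X t 3 * q * (c' * (X t 2)⁻¹)| ≤ 6 * K ^ 10 * (1 / K ^ 100) := by
    rw [abs_mul, abs_mul, abs_mul, abs_of_nonneg hq0, abs_of_nonneg hrat0]
    calc |X t 0| * |X t 3| * q * (c' * (X t 2)⁻¹) ≤ 1 * 1 * (1 / K ^ 100) * (6 * K ^ 10) := by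
          gcongr
      _ = 6 * K ^ 10 * (1 / K ^ 100) := by ring
  have hsum : (2 + K) * (1 / K ^ 100) + 6 * K ^ 10 * (1 / K ^ 100) ≤ 9 / K ^ 90 := by
    have h10 : 2 + K ≤ 3 * K ^ 10 := by
      have : K ≤ K ^ 10 := le_self_pow₀ hK1 (by norm_num)
      linarith
    rw [show 9 / K ^ 90 = 9 * K ^ 10 * (1 / K ^ 100) by field_simp]
    have : 0 ≤ 1 / K ^ 100 := by positivity
    nlinarith
  calc _ ≤ |(-(ε * X t 0 * X t 1 * X t 3 + ε ^ 2 * exp (-K ^ 10) * X t 0 * X t 2 * X t 3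
        + K * X t 0 * X t 3 * X t 4) * q)| + |X t 0 * X t 3 * q * (c' * (X t 2)⁻¹)| :=
        abs_sub _ _
    _ ≤ (2 + K) * (1 / K ^ 100) + 6 * K ^ 10 * (1 / K ^ 100) := add_le_add hT1 hT2
    _ ≤ 9 / K ^ 90 := hsum

end PhaseTwo


section PhaseThree

/-! ## The claim (atc): `ã(t_c + 1/K) ≥ 1/10` -/

variable {K ε κ τ : ℝ} {X : ℝ → Fin 5 → ℝ}

/-- **(atc)**: `ã(t_c + 1/K) ≥ 1/10`. If not, on `J = [t_c + K⁻⁹, t_c + 1/K]` one has `ã ≤ 1/10`,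
hence `a² + d² ≥ 0.98`, while `Ψ = V + 2ã/K` has `∂ₜΨ = a² + d² + O(K⁻⁹⁰)` and total variation
`≤ 2K⁻¹⁰⁰ + 0.2/K` over `J` — a contradiction. [cite: Tao2016AveragedNS, §5.5 (atc)] -/
theorem e_tenth (hX : ∀ t, HasDerivAt X (delayCircuit K ε (X t)) t) (h0 : IsKicked K ε κ X)
    (hε : 0 < ε) (hε1 : ε ≤ 1) (hK : 16 ≤ K) (hεK : ε ^ 2 ≤ 1 / (6 * K ^ 20))
    (hεexp : ε ^ 2 ≤ exp (-(20 * K ^ 10)) / (144 * K ^ 10)) (hN3 : K ^ 110 ≤ exp (K / 8))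
    (hτ1 : 1 ≤ τ) (hτ74 : τ < 7 / 4)
    (hcτ : ∀ t, 0 ≤ t → t ≤ τ → X t 2 ≤ ε ^ 2 / K ^ 10) (hcτeq : X τ 2 = ε ^ 2 / K ^ 10) :
    1 / 10 ≤ X (τ + K⁻¹) 4 := by
  have hK0 : 0 < K := by linarith
  have hK1 : 1 ≤ K := by linarith
  have hτ2 : τ ≤ 2 := by linarith
  set t₀ : ℝ := τ + (K ^ 9)⁻¹ with ht₀
  set t₁ : ℝ := τ + K⁻¹ with ht₁
  have hK9 : (K ^ 9)⁻¹ ≤ K⁻¹ := by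
    rw [inv_le_inv₀ (by positivity) hK0]; exact le_self_pow₀ hK1 (by norm_num)
  have hKinv : K⁻¹ ≤ 1 / 16 := by rw [inv_le_comm₀ hK0 (by norm_num)]; linarith
  have h01 : t₀ ≤ t₁ := by simp only [ht₀, ht₁]; linarith
  have ht12 : t₁ ≤ 2 := by simp only [ht₁]; linarith
  have hJI : ∀ s ∈ Icc t₀ t₁, s ∈ Icc (τ + (K ^ 9)⁻¹) 2 := fun s hs => ⟨hs.1, hs.2.trans ht12⟩
  -- numeric facts
  have hK20 : (2 : ℝ) ^ 20 ≤ K ^ 20 := pow_le_pow_left₀ (by norm_num) (by linarith) 20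
  have hK90 : (2 : ℝ) ^ 90 ≤ K ^ 90 := pow_le_pow_left₀ (by norm_num) (by linarith) 90
  have hε2 : (5 * ε) ^ 2 ≤ 1 / 1000 := by
    have h6 : 1 / (6 * K ^ 20) ≤ 1 / 25000 := by
      apply one_div_le_one_div_of_le (by norm_num); linarith
    have : (5 * ε) ^ 2 = 25 * ε ^ 2 := by ring
    rw [this]; linarith
  have hK90' : 9 / K ^ 90 ≤ 1 / 1000 := by
    rw [div_le_div_iff₀ (by positivity) (by norm_num)]; linarith
  by_contra hlt'
  have hlt := not_le.1 hlt'
  have hmonoE := delayCircuit_output_monotone hK0.le hX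
  -- `Ψ = V + (2/K) ã` has derivative `≥ 0.97` on `J`
  have hmono := monotoneOn_sub_of_le_deriv (φ := fun _ => (97 : ℝ) / 100)
    (Φ := fun s => 97 / 100 * s) (convex_Icc t₀ t₁)
    (f := fun s => X s 0 * X s 3 * (ε ^ 2 * (X s 2)⁻¹) + 2 / K * X s 4)
    (fun s hs => by
      have hsI := hJI s hs
      have hcl : K ^ 100 * ε ^ 2 ≤ X s 2 :=
        c_large hX h0 hε hε1 hK hεK hεexp hN3 hτ1 hτ2 hcτ hcτeq hsI
      have hcne : X s 2 ≠ 0 := (lt_of_lt_of_le (by positivity) hcl).ne'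
      exact (hasDerivAt_V hX hε.ne' hcne).add ((hasDerivAt_e hX s).const_mul (2 / K)))
    (fun s _ => ((hasDerivAt_id s).const_mul ((97 : ℝ) / 100)).congr_deriv (by simp))
    (fun s hs => by
      have hsI := hJI s hs
      have hs02 : s ∈ Icc (0 : ℝ) 2 := ⟨by linarith [hs.1, inv_pos.2 (pow_pos hK0 9)], hsI.2⟩
      have hR := V_remainder_le hX h0 hε hε1 hK hεK hεexp hN3 hτ1 hτ2 hcτ hcτeq hsI
      have hRlo := (abs_le.1 hR).1
      have hsum := traj_sum_sq_eq_one hX h0 s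
      obtain ⟨hb5, hc5⟩ := bc_small hX h0 hε hε1 hs02
      have hb2 : X s 1 ^ 2 ≤ (5 * ε) ^ 2 := by
        rw [← sq_abs]; exact pow_le_pow_left₀ (abs_nonneg _) hb5 2
      have hc2 : X s 2 ^ 2 ≤ (5 * ε) ^ 2 := by
        rw [← sq_abs]; exact pow_le_pow_left₀ (abs_nonneg _) hc5 2
      have hes : X s 4 ≤ 1 / 10 := (hmonoE hs.2).trans hlt.le
      have hes0 : 0 ≤ X s 4 := e_nonneg hX h0 hK0.le hs02.1
      have he2 : X s 4 ^ 2 ≤ 1 / 100 := by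
        have := pow_le_pow_left₀ hes0 hes 2; norm_num at this; exact this
      have hKd : 2 / K * (K * X s 3 ^ 2) = 2 * X s 3 ^ 2 := by field_simp
      rw [hKd]
      linarith)
  have hmem0 : t₀ ∈ Icc t₀ t₁ := ⟨le_rfl, h01⟩
  have hmem1 : t₁ ∈ Icc t₀ t₁ := ⟨h01, le_rfl⟩
  have h := hmono hmem0 hmem1 h01
  simp only at h
  -- sizes of `V` at the endpoints and of `ã`
  have hV : ∀ s ∈ Icc t₀ t₁, |X s 0 * X s 3 * (ε ^ 2 * (X s 2)⁻¹)| ≤ 1 / K ^ 100 := by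
    intro s hs
    have hsI := hJI s hs
    have hcl : K ^ 100 * ε ^ 2 ≤ X s 2 :=
      c_large hX h0 hε hε1 hK hεK hεexp hN3 hτ1 hτ2 hcτ hcτeq hsI
    have hcpos : 0 < X s 2 := lt_of_lt_of_le (by positivity) hcl
    have hq0 : 0 ≤ ε ^ 2 * (X s 2)⁻¹ := by positivity
    have hq : ε ^ 2 * (X s 2)⁻¹ ≤ 1 / K ^ 100 := by
      rw [← div_eq_mul_inv, div_le_div_iff₀ hcpos (by positivity), one_mul]; linarith
    rw [abs_mul, abs_mul, abs_of_nonneg hq0]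
    calc |X s 0| * |X s 3| * (ε ^ 2 * (X s 2)⁻¹) ≤ 1 * 1 * (1 / K ^ 100) :=
          mul_le_mul (mul_le_mul (traj_abs_le_one hX h0 s 0) (traj_abs_le_one hX h0 s 3) (abs_nonneg _)
            zero_le_one) hq hq0 (by norm_num)
      _ = 1 / K ^ 100 := by ring
  have hV0 := (abs_le.1 (hV t₀ hmem0)).1
  have hV1 := (abs_le.1 (hV t₁ hmem1)).2
  have he0 : 0 ≤ X t₀ 4 := e_nonneg hX h0 hK0.le (by simp only [ht₀]; positivity)
  have hlen : t₁ - t₀ = K⁻¹ - (K ^ 9)⁻¹ := by simp only [ht₀, ht₁]; ring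
  -- numeric contradiction, in the variable `u = 1/K`
  set u : ℝ := K⁻¹ with hu
  have hu0 : 0 < u := by positivity
  have hK8 : (2 : ℝ) ^ 8 ≤ K ^ 8 := pow_le_pow_left₀ (by norm_num) (by linarith) 8
  have hK99 : (2 : ℝ) ^ 8 ≤ K ^ 99 := hK8.trans (pow_le_pow_right₀ hK1 (by norm_num))
  have hi8 : (K ^ 8)⁻¹ ≤ 1 / 256 := by
    rw [one_div, inv_le_inv₀ (by positivity) (by norm_num)]; linarith
  have hi99 : (K ^ 99)⁻¹ ≤ 1 / 256 := by
    rw [one_div, inv_le_inv₀ (by positivity) (by norm_num)]; linarith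
  have h9 : (K ^ 9)⁻¹ ≤ u * (1 / 256) := by
    rw [show (K ^ 9)⁻¹ = u * (K ^ 8)⁻¹ by simp only [hu]; rw [← mul_inv, ← pow_succ']]
    exact mul_le_mul_of_nonneg_left hi8 hu0.le
  have h100 : 1 / K ^ 100 ≤ u * (1 / 256) := by
    rw [show 1 / K ^ 100 = u * (K ^ 99)⁻¹ by
      simp only [hu]; rw [← mul_inv, ← pow_succ', one_div]]
    exact mul_le_mul_of_nonneg_left hi99 hu0.le
  have hKu : 2 / K * X t₁ 4 - 2 / K * X t₀ 4 ≤ 2 * u * (1 / 10) := by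
    have : 2 / K * X t₁ 4 - 2 / K * X t₀ 4 = 2 * u * (X t₁ 4 - X t₀ 4) := by
      simp only [hu]; ring
    rw [this]
    exact mul_le_mul_of_nonneg_left (by linarith) (by positivity)
  have hfin : 97 / 100 * (t₁ - t₀) ≤ 2 * (u * (1 / 256)) + 2 * u * (1 / 10) := by linarith
  rw [hlen] at hfin
  nlinarith

/-! ## Equipartition energy `E_*` and its decay (toke) -/

/-- Dissipation inequality for `E_*` on `[t', 2]`, `t' = t_c + 1/K`:
`∂ₜE_* + Kã(t')E_* ≤ 7K⁻⁸⁹`. [cite: Tao2016AveragedNS, §5.5 (proof of (beable))] -/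
theorem Es_dissipation (hX : ∀ t, HasDerivAt X (delayCircuit K ε (X t)) t) (h0 : IsKicked K ε κ X)
    (hε : 0 < ε) (hε1 : ε ≤ 1) (hK : 16 ≤ K) (hεK : ε ^ 2 ≤ 1 / (6 * K ^ 20))
    (hε100 : ε ≤ 1 / K ^ 100)
    (hεexp : ε ^ 2 ≤ exp (-(20 * K ^ 10)) / (144 * K ^ 10)) (hN3 : K ^ 110 ≤ exp (K / 8))
    (hτ1 : 1 ≤ τ) (hτ74 : τ < 7 / 4)
    (hcτ : ∀ t, 0 ≤ t → t ≤ τ → X t 2 ≤ ε ^ 2 / K ^ 10) (hcτeq : X τ 2 = ε ^ 2 / K ^ 10)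
    {s : ℝ} (hs : s ∈ Icc (τ + K⁻¹) 2) :
    (-(K / 2) * X s 4 * (X s 0 ^ 2 + X s 3 ^ 2)
        - K / 2 * ((-(ε * X s 0 * X s 1 * X s 3 + ε ^ 2 * exp (-K ^ 10) * X s 0 * X s 2 * X s 3
            + K * X s 0 * X s 3 * X s 4) * (ε ^ 2 * (X s 2)⁻¹)
          - X s 0 * X s 3 * (ε ^ 2 * (X s 2)⁻¹) *
            ((ε ^ 2 * exp (-K ^ 10) * X s 0 ^ 2 + ε⁻¹ * K ^ 10 * X s 1 * X s 2) * (X s 2)⁻¹)))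
          * X s 4
        - K ^ 2 / 2 * (X s 0 * X s 3 * (ε ^ 2 * (X s 2)⁻¹)) * X s 3 ^ 2)
      + K * X (τ + K⁻¹) 4 * ((1 - X s 4 * X s 4) / 2
        - K / 2 * (X s 0 * X s 3 * (ε ^ 2 * (X s 2)⁻¹) * X s 4)) ≤ 7 / K ^ 89 := by
  have hK0 : 0 < K := by linarith
  have hK1 : 1 ≤ K := by linarith
  have hτ2 : τ ≤ 2 := by linarith
  have hK9 : (K ^ 9)⁻¹ ≤ K⁻¹ := by
    rw [inv_le_inv₀ (by positivity) hK0]; exact le_self_pow₀ hK1 (by norm_num)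
  have hsI : s ∈ Icc (τ + (K ^ 9)⁻¹) 2 := ⟨by linarith [hs.1], hs.2⟩
  have hs02 : s ∈ Icc (0 : ℝ) 2 := ⟨by linarith [hs.1, inv_pos.2 hK0], hs.2⟩
  have hcl : K ^ 100 * ε ^ 2 ≤ X s 2 := c_large hX h0 hε hε1 hK hεK hεexp hN3 hτ1 hτ2 hcτ hcτeq hsI
  have hcpos : 0 < X s 2 := lt_of_lt_of_le (by positivity) hcl
  have hq0 : 0 ≤ ε ^ 2 * (X s 2)⁻¹ := by positivity
  have hq1 : ε ^ 2 * (X s 2)⁻¹ ≤ 1 / K ^ 100 := by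
    rw [← div_eq_mul_inv, div_le_div_iff₀ hcpos (by positivity), one_mul]; linarith
  obtain ⟨hb5, hc5⟩ := bc_small hX h0 hε hε1 hs02
  have hb2 : X s 1 ^ 2 ≤ (5 * ε) ^ 2 := by
    rw [← sq_abs]; exact pow_le_pow_left₀ (abs_nonneg _) hb5 2
  have hc2 : X s 2 ^ 2 ≤ (5 * ε) ^ 2 := by
    rw [← sq_abs]; exact pow_le_pow_left₀ (abs_nonneg _) hc5 2
  have hmonoE := delayCircuit_output_monotone hK0.le hX
  exact Es_alg hK (traj_sum_sq_eq_one hX h0 s) hq0 hq1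
    (V_remainder_le hX h0 hε hε1 hK hεK hεexp hN3 hτ1 hτ2 hcτ hcτeq hsI)
    (traj_abs_le_one hX h0 s 0) (traj_abs_le_one hX h0 s 3) (traj_abs_le_one hX h0 s 4)
    (e_nonneg hX h0 hK0.le (by positivity))
    ((le_abs_self _).trans (traj_abs_le_one hX h0 _ 4)) (hmonoE hs.1) hb2 hc2 hε hε1 hε100

end PhaseThree


section Decay

variable {K ε κ τ : ℝ} {X : ℝ → Fin 5 → ℝ}

/-- On `I = [t_c + K⁻⁹, 2]`: `|½K·V·ã| ≤ ½K⁻⁹⁹` (`V = adε²/c`, `ε²/c ≤ K⁻¹⁰⁰`).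
[cite: Tao2016AveragedNS, §5.5 (proof of (beable))] -/
theorem KVe_small (hX : ∀ t, HasDerivAt X (delayCircuit K ε (X t)) t) (h0 : IsKicked K ε κ X)
    (hε : 0 < ε) (hε1 : ε ≤ 1) (hK : 16 ≤ K) (hεK : ε ^ 2 ≤ 1 / (6 * K ^ 20))
    (hεexp : ε ^ 2 ≤ exp (-(20 * K ^ 10)) / (144 * K ^ 10)) (hN3 : K ^ 110 ≤ exp (K / 8))
    (hτ1 : 1 ≤ τ) (hτ2 : τ ≤ 2)
    (hcτ : ∀ t, 0 ≤ t → t ≤ τ → X t 2 ≤ ε ^ 2 / K ^ 10) (hcτeq : X τ 2 = ε ^ 2 / K ^ 10)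
    {s : ℝ} (hs : s ∈ Icc (τ + (K ^ 9)⁻¹) 2) :
    |K / 2 * (X s 0 * X s 3 * (ε ^ 2 * (X s 2)⁻¹) * X s 4)| ≤ 1 / 2 / K ^ 99 := by
  have hK0 : 0 < K := by linarith
  have hcl : K ^ 100 * ε ^ 2 ≤ X s 2 :=
    c_large hX h0 hε hε1 hK hεK hεexp hN3 hτ1 hτ2 hcτ hcτeq hs
  have hcpos : 0 < X s 2 := lt_of_lt_of_le (by positivity) hcl
  have hq0 : 0 ≤ ε ^ 2 * (X s 2)⁻¹ := by positivity
  have hq : ε ^ 2 * (X s 2)⁻¹ ≤ 1 / K ^ 100 := by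
    rw [← div_eq_mul_inv, div_le_div_iff₀ hcpos (by positivity), one_mul]; linarith
  rw [abs_mul, abs_of_pos (by positivity : 0 < K / 2), abs_mul, abs_mul, abs_mul,
    abs_of_nonneg hq0]
  calc K / 2 * (|X s 0| * |X s 3| * (ε ^ 2 * (X s 2)⁻¹) * |X s 4|)
      ≤ K / 2 * (1 * 1 * (1 / K ^ 100) * 1) := by
        refine mul_le_mul_of_nonneg_left ?_ (by positivity)
        exact mul_le_mul (mul_le_mul (mul_le_mul (traj_abs_le_one hX h0 s 0)
          (traj_abs_le_one hX h0 s 3) (abs_nonneg _) zero_le_one) hq hq0 (by norm_num))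
          (traj_abs_le_one hX h0 s 4) (abs_nonneg _) (by positivity)
    _ = 1 / 2 / K ^ 99 := by field_simp

/-- **(toke)**: on `[t_c + 1/√K, 2]`,
`E_*(t) ≤ e^{-Kã(t')(t-t')} + 7K⁻⁸⁹/(Kã(t')) ≤ e^{(1-√K)/10} + 70K⁻⁹⁰` (Grönwall from
`t' = t_c + 1/K`, `ã(t') ≥ 1/10`). [cite: Tao2016AveragedNS, §5.5 (toke)] -/
theorem Es_decay (hX : ∀ t, HasDerivAt X (delayCircuit K ε (X t)) t) (h0 : IsKicked K ε κ X)
    (hε : 0 < ε) (hε1 : ε ≤ 1) (hK : 16 ≤ K) (hεK : ε ^ 2 ≤ 1 / (6 * K ^ 20))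
    (hε100 : ε ≤ 1 / K ^ 100)
    (hεexp : ε ^ 2 ≤ exp (-(20 * K ^ 10)) / (144 * K ^ 10)) (hN3 : K ^ 110 ≤ exp (K / 8))
    (hτ1 : 1 ≤ τ) (hτ74 : τ < 7 / 4)
    (hcτ : ∀ t, 0 ≤ t → t ≤ τ → X t 2 ≤ ε ^ 2 / K ^ 10) (hcτeq : X τ 2 = ε ^ 2 / K ^ 10)
    {t : ℝ} (ht : t ∈ Icc (τ + 1 / sqrt K) 2) :
    (1 - X t 4 * X t 4) / 2 - K / 2 * (X t 0 * X t 3 * (ε ^ 2 * (X t 2)⁻¹) * X t 4)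
      ≤ exp ((1 - sqrt K) / 10) + 70 / K ^ 90 := by
  have hK0 : 0 < K := by linarith
  have hK1 : 1 ≤ K := by linarith
  have hτ2 : τ ≤ 2 := by linarith
  obtain ⟨hs0, hs4, hKs, h4, hKs2⟩ := invSqrt_facts hK
  have he₀ : 1 / 10 ≤ X (τ + K⁻¹) 4 := e_tenth hX h0 hε hε1 hK hεK hεexp hN3 hτ1 hτ74 hcτ hcτeq
  have he₀pos : 0 < X (τ + K⁻¹) 4 := lt_of_lt_of_le (by norm_num) he₀
  have hKe : 0 < K * X (τ + K⁻¹) 4 := mul_pos hK0 he₀pos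
  have hK9 : (K ^ 9)⁻¹ ≤ K⁻¹ := by
    rw [inv_le_inv₀ (by positivity) hK0]; exact le_self_pow₀ hK1 (by norm_num)
  have hKinv : K⁻¹ ≤ (sqrt K)⁻¹ := by
    rw [inv_le_inv₀ hK0 (by positivity)]
    calc sqrt K ≤ sqrt K * sqrt K := le_mul_of_one_le_right (by positivity) (by linarith)
      _ = K := mul_self_sqrt hK0.le
  have ht't : τ + K⁻¹ ≤ t := by rw [one_div] at ht; linarith [ht.1]
  have hI : ∀ s ∈ Icc (τ + K⁻¹) 2, s ∈ Icc (τ + (K ^ 9)⁻¹) 2 := fun s hs =>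
    ⟨by linarith [hs.1], hs.2⟩
  have hC0 : 0 ≤ 7 / K ^ 89 / (K * X (τ + K⁻¹) 4) := by positivity
  -- Grönwall in integrating-factor form
  have hanti := antitoneOn_intFactor (s := Icc (τ + K⁻¹) 2)
    (f := fun s => (1 - X s 4 * X s 4) / 2 - K / 2 * (X s 0 * X s 3 * (ε ^ 2 * (X s 2)⁻¹) * X s 4))
    (g := fun _ => -(K * X (τ + K⁻¹) 4)) (G := fun s => -(K * X (τ + K⁻¹) 4 * s))
    (φ := fun s => 7 / K ^ 89 * exp (K * X (τ + K⁻¹) 4 * s))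
    (Φ := fun s => 7 / K ^ 89 / (K * X (τ + K⁻¹) 4) * exp (K * X (τ + K⁻¹) 4 * s))
    (convex_Icc _ 2)
    (fun s hs => by
      have hsI := hI s hs
      have hcl : K ^ 100 * ε ^ 2 ≤ X s 2 :=
        c_large hX h0 hε hε1 hK hεK hεexp hN3 hτ1 hτ2 hcτ hcτeq hsI
      have hcne : X s 2 ≠ 0 := (lt_of_lt_of_le (by positivity) hcl).ne'
      exact hasDerivAt_Es hX hε.ne' hcne)
    (fun s _ => ((hasDerivAt_id s).const_mul (K * X (τ + K⁻¹) 4)).neg.congr_deriv (by simp))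
    (fun s _ => by
      have hne : K * X (τ + K⁻¹) 4 ≠ 0 := hKe.ne'
      have := (((hasDerivAt_id s).const_mul (K * X (τ + K⁻¹) 4)).exp).const_mul
        (7 / K ^ 89 / (K * X (τ + K⁻¹) 4))
      refine this.congr_deriv ?_
      simp only [mul_one, id_eq]
      generalize X (τ + K⁻¹) 4 = e₀ at hne ⊢
      have hne' : e₀ ≠ 0 := right_ne_zero_of_mul hne
      field_simp)
    (fun s hs => by
      have hdis := Es_dissipation hX h0 hε hε1 hK hεK hε100 hεexp hN3 hτ1 hτ74 hcτ hcτeq hs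
      have hE : exp (-(-(K * X (τ + K⁻¹) 4 * s))) = exp (K * X (τ + K⁻¹) 4 * s) := by
        rw [neg_neg]
      rw [hE]
      have h2 := mul_le_mul_of_nonneg_right hdis (exp_pos (K * X (τ + K⁻¹) 4 * s)).le
      linarith)
  have ht'mem : τ + K⁻¹ ∈ Icc (τ + K⁻¹) 2 :=
    ⟨le_rfl, by linarith [inv_le_one_of_one_le₀ hK1]⟩
  have htmem : t ∈ Icc (τ + K⁻¹) 2 := ⟨ht't, ht.2⟩
  have hA := hanti ht'mem htmem ht't
  simp only [neg_neg] at hA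
  have hsplit : exp (K * X (τ + K⁻¹) 4 * (τ + K⁻¹))
      = exp (K * X (τ + K⁻¹) 4 * t) * exp (K * X (τ + K⁻¹) 4 * ((τ + K⁻¹) - t)) := by
    rw [← exp_add]; congr 1; ring
  rw [hsplit] at hA
  -- `E_*(t') ≤ 1`
  have hEs1 : (1 - X (τ + K⁻¹) 4 * X (τ + K⁻¹) 4) / 2
      - K / 2 * (X (τ + K⁻¹) 0 * X (τ + K⁻¹) 3 * (ε ^ 2 * (X (τ + K⁻¹) 2)⁻¹) * X (τ + K⁻¹) 4)
      ≤ 1 := by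
    have h1 : (1 - X (τ + K⁻¹) 4 * X (τ + K⁻¹) 4) / 2 ≤ 1 / 2 := by
      nlinarith [mul_self_nonneg (X (τ + K⁻¹) 4)]
    have h2 := (abs_le.1 (KVe_small hX h0 hε hε1 hK hεK hεexp hN3 hτ1 hτ2 hcτ hcτeq
      (hI _ ht'mem))).1
    have h3 : 1 / 2 / K ^ 99 ≤ 1 / 2 := by
      rw [div_le_iff₀ (by positivity)]
      have : (1 : ℝ) ≤ K ^ 99 := one_le_pow₀ hK1
      linarith
    linarith
  have hρ0 : 0 < exp (K * X (τ + K⁻¹) 4 * ((τ + K⁻¹) - t)) := exp_pos _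
  have hEst := decay_alg (exp_pos _) hρ0 hC0 hEs1 hA
  -- `ρ ≤ exp((1 - √K)/10)`
  have hρle : exp (K * X (τ + K⁻¹) 4 * ((τ + K⁻¹) - t)) ≤ exp ((1 - sqrt K) / 10) := by
    rw [exp_le_exp]
    have h1 : K * X (τ + K⁻¹) 4 * ((τ + K⁻¹) - t) ≤ K * (1 / 10) * ((τ + K⁻¹) - t) := by
      have hn : (τ + K⁻¹) - t ≤ 0 := by linarith
      have := mul_le_mul_of_nonpos_right (mul_le_mul_of_nonneg_left he₀ hK0.le) hn
      linarith
    have h2 : K * (1 / 10) * ((τ + K⁻¹) - t) ≤ K * (1 / 10) * (K⁻¹ - (sqrt K)⁻¹) := by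
      refine mul_le_mul_of_nonneg_left ?_ (by positivity)
      rw [one_div] at ht; linarith [ht.1]
    have h3 : K * (1 / 10) * (K⁻¹ - (sqrt K)⁻¹) = (1 - sqrt K) / 10 := by
      have : K * (sqrt K)⁻¹ = sqrt K := hKs
      have hKK : K * K⁻¹ = 1 := mul_inv_cancel₀ hK0.ne'
      calc K * (1 / 10) * (K⁻¹ - (sqrt K)⁻¹) = (K * K⁻¹ - K * (sqrt K)⁻¹) / 10 := by ring
        _ = (1 - sqrt K) / 10 := by rw [this, hKK]
    linarith
  have hCle : 7 / K ^ 89 / (K * X (τ + K⁻¹) 4) ≤ 70 / K ^ 90 := by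
    rw [div_le_div_iff₀ hKe (by positivity)]
    calc 7 / K ^ 89 * K ^ 90 = 7 * K := by field_simp
      _ = 70 * (K * (1 / 10)) := by ring
      _ ≤ 70 * (K * X (τ + K⁻¹) 4) := by
          have := mul_le_mul_of_nonneg_left he₀ hK0.le
          linarith
  linarith

/-- **(toke) ⇒ (beable), core estimate**: on `[t_c + 1/√K, 2]`, `a² + d² ≤ 142K⁻²⁰`
(`a² + d² = 2E_* + KVã - b² - c²`). [cite: Tao2016AveragedNS, §5.5 (beable)] -/
theorem ad_small_late (hX : ∀ t, HasDerivAt X (delayCircuit K ε (X t)) t) (h0 : IsKicked K ε κ X)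
    (hε : 0 < ε) (hε1 : ε ≤ 1) (hK : 16 ≤ K) (hεK : ε ^ 2 ≤ 1 / (6 * K ^ 20))
    (hε100 : ε ≤ 1 / K ^ 100)
    (hεexp : ε ^ 2 ≤ exp (-(20 * K ^ 10)) / (144 * K ^ 10)) (hN3 : K ^ 110 ≤ exp (K / 8))
    (hN4 : 2 * exp ((1 - sqrt K) / 10) ≤ 1 / K ^ 20)
    (hτ1 : 1 ≤ τ) (hτ74 : τ < 7 / 4)
    (hcτ : ∀ t, 0 ≤ t → t ≤ τ → X t 2 ≤ ε ^ 2 / K ^ 10) (hcτeq : X τ 2 = ε ^ 2 / K ^ 10)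
    {t : ℝ} (ht : t ∈ Icc (τ + 1 / sqrt K) 2) : X t 0 ^ 2 + X t 3 ^ 2 ≤ 142 / K ^ 20 := by
  have hK0 : 0 < K := by linarith
  have hK1 : 1 ≤ K := by linarith
  have hτ2 : τ ≤ 2 := by linarith
  obtain ⟨hs0, hs4, hKs, h4, hKs2⟩ := invSqrt_facts hK
  have hKinv : K⁻¹ ≤ (sqrt K)⁻¹ := by
    rw [inv_le_inv₀ hK0 (by positivity)]
    calc sqrt K ≤ sqrt K * sqrt K := le_mul_of_one_le_right (by positivity) (by linarith)
      _ = K := mul_self_sqrt hK0.le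
  have hK9 : (K ^ 9)⁻¹ ≤ K⁻¹ := by
    rw [inv_le_inv₀ (by positivity) hK0]; exact le_self_pow₀ hK1 (by norm_num)
  have htI : t ∈ Icc (τ + (K ^ 9)⁻¹) 2 := ⟨by rw [one_div] at ht; linarith [ht.1], ht.2⟩
  have hEs := Es_decay hX h0 hε hε1 hK hεK hε100 hεexp hN3 hτ1 hτ74 hcτ hcτeq ht
  have hVt := (abs_le.1 (KVe_small hX h0 hε hε1 hK hεK hεexp hN3 hτ1 hτ2 hcτ hcτeq htI)).2
  have hsum := traj_sum_sq_eq_one hX h0 t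
  have h99 : 1 / 2 / K ^ 99 ≤ 1 / 2 / K ^ 20 := by
    apply div_le_div_of_nonneg_left (by norm_num) (by positivity)
    exact pow_le_pow_right₀ hK1 (by norm_num)
  have h90 : 70 / K ^ 90 ≤ 70 / K ^ 20 := by
    apply div_le_div_of_nonneg_left (by norm_num) (by positivity)
    exact pow_le_pow_right₀ hK1 (by norm_num)
  have hexp20 : exp ((1 - sqrt K) / 10) ≤ 1 / 2 / K ^ 20 := by
    have h := hN4
    rw [div_div, le_div_iff₀ (by positivity)]
    rw [le_div_iff₀ (by positivity)] at h
    linarith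
  -- express everything in the single atom `w = (K²⁰)⁻¹`
  have hw1 : (1 : ℝ) / 2 / K ^ 20 = 1 / 2 * (K ^ 20)⁻¹ := by ring
  have hw2 : (70 : ℝ) / K ^ 20 = 70 * (K ^ 20)⁻¹ := by ring
  have hw3 : (142 : ℝ) / K ^ 20 = 142 * (K ^ 20)⁻¹ := by ring
  rw [hw3]
  rw [hw1] at hexp20 h99
  rw [hw2] at h90
  have hee : X t 4 * X t 4 = X t 4 ^ 2 := by ring
  linarith [sq_nonneg (X t 1), sq_nonneg (X t 2)]

/-- **(beable), squared form**: for `t ≥ t_c + 1/√K`, `a² + b² + c² + d² ≤ 143K⁻²⁰` (on `[·,2]` from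
`ad_small_late` and `b, c = O(ε)`; for `t ≥ 2` by monotonicity of `ã` and (energy-con)).
[cite: Tao2016AveragedNS, §5.5 (beable)] -/
theorem late_sum_sq (hX : ∀ t, HasDerivAt X (delayCircuit K ε (X t)) t) (h0 : IsKicked K ε κ X)
    (hε : 0 < ε) (hε1 : ε ≤ 1) (hK : 16 ≤ K) (hεK : ε ^ 2 ≤ 1 / (6 * K ^ 20))
    (hε100 : ε ≤ 1 / K ^ 100)
    (hεexp : ε ^ 2 ≤ exp (-(20 * K ^ 10)) / (144 * K ^ 10)) (hN3 : K ^ 110 ≤ exp (K / 8))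
    (hN4 : 2 * exp ((1 - sqrt K) / 10) ≤ 1 / K ^ 20)
    (hτ1 : 1 ≤ τ) (hτ74 : τ < 7 / 4)
    (hcτ : ∀ t, 0 ≤ t → t ≤ τ → X t 2 ≤ ε ^ 2 / K ^ 10) (hcτeq : X τ 2 = ε ^ 2 / K ^ 10)
    {t : ℝ} (ht : τ + 1 / sqrt K ≤ t) :
    X t 0 ^ 2 + X t 1 ^ 2 + X t 2 ^ 2 + X t 3 ^ 2 ≤ 143 / K ^ 20 := by
  have hK0 : 0 < K := by linarith
  have hK1 : 1 ≤ K := by linarith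
  obtain ⟨hs0, hs4, hKs, h4, hKs2⟩ := invSqrt_facts hK
  -- `b² + c² ≤ K⁻²⁰` on `[0,2]`
  have hbc : ∀ s ∈ Icc (0 : ℝ) 2, X s 1 ^ 2 + X s 2 ^ 2 ≤ 1 / K ^ 20 := by
    intro s hs
    obtain ⟨hb5, hc5⟩ := bc_small hX h0 hε hε1 hs
    have hb2 : X s 1 ^ 2 ≤ (5 * ε) ^ 2 := by
      rw [← sq_abs]; exact pow_le_pow_left₀ (abs_nonneg _) hb5 2
    have hc2 : X s 2 ^ 2 ≤ (5 * ε) ^ 2 := by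
      rw [← sq_abs]; exact pow_le_pow_left₀ (abs_nonneg _) hc5 2
    have hεε : ε ^ 2 ≤ ε := by
      calc ε ^ 2 = ε * ε := sq ε
        _ ≤ ε * 1 := mul_le_mul_of_nonneg_left hε1 hε.le
        _ = ε := mul_one ε
    have h50 : 50 * (1 / K ^ 100) ≤ 1 / K ^ 20 := by
      rw [mul_one_div, div_le_div_iff₀ (by positivity) (by positivity), one_mul]
      have h80 : (50 : ℝ) ≤ K ^ 80 := by
        have : (16 : ℝ) ^ 80 ≤ K ^ 80 := pow_le_pow_left₀ (by norm_num) hK 80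
        linarith
      calc (50 : ℝ) * K ^ 20 ≤ K ^ 80 * K ^ 20 := mul_le_mul_of_nonneg_right h80 (by positivity)
        _ = K ^ 100 := by ring
    have : (5 * ε) ^ 2 = 25 * ε ^ 2 := by ring
    linarith [hεε.trans hε100]
  have hle2 : ∀ s, τ + 1 / sqrt K ≤ s → s ≤ 2 →
      X s 0 ^ 2 + X s 1 ^ 2 + X s 2 ^ 2 + X s 3 ^ 2 ≤ 143 / K ^ 20 := by
    intro s hs1 hs2
    have had := ad_small_late hX h0 hε hε1 hK hεK hε100 hεexp hN3 hN4 hτ1 hτ74 hcτ hcτeq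
      ⟨hs1, hs2⟩
    have hs0 : 0 ≤ s := by rw [one_div] at hs1; linarith
    have := hbc s ⟨hs0, hs2⟩
    have : 142 / K ^ 20 + 1 / K ^ 20 = 143 / K ^ 20 := by ring
    linarith
  by_cases h2 : t ≤ 2
  · exact hle2 t ht h2
  · -- `t > 2`: monotonicity of `ã` from time `2`
    have h2' : 2 < t := not_le.1 h2
    have hτs : τ + 1 / sqrt K ≤ 2 := by rw [one_div]; linarith
    have hS2 := hle2 2 hτs le_rfl
    have hsum2 := traj_sum_sq_eq_one hX h0 2
    have hsumt := traj_sum_sq_eq_one hX h0 t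
    have hmonoE := delayCircuit_output_monotone hK0.le hX
    have he2t : X 2 4 ≤ X t 4 := hmonoE h2'.le
    have he20 : 0 ≤ X 2 4 := e_nonneg hX h0 hK0.le (by norm_num)
    have hsq : X 2 4 ^ 2 ≤ X t 4 ^ 2 := pow_le_pow_left₀ he20 he2t 2
    linarith

/-- From `∑_{i≠4} Xᵢ² ≤ 143K⁻²⁰` and (energy-con): all of (beable) with constant `200`.
[cite: Tao2016AveragedNS, §5.5 (beable)] -/
theorem beable_of_sum_sq (hX : ∀ t, HasDerivAt X (delayCircuit K ε (X t)) t)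
    (h0 : IsKicked K ε κ X) (hK : 16 ≤ K) {t : ℝ} (ht0 : 0 ≤ t)
    (hS : X t 0 ^ 2 + X t 1 ^ 2 + X t 2 ^ 2 + X t 3 ^ 2 ≤ 143 / K ^ 20) :
    |X t 4 - 1| ≤ 200 / K ^ 10 ∧ ∀ i : Fin 5, i ≠ 4 → |X t i| ≤ 200 / K ^ 10 := by
  have hK0 : 0 < K := by linarith
  have hK1 : 1 ≤ K := by linarith
  have hsum := traj_sum_sq_eq_one hX h0 t
  have he0 : 0 ≤ X t 4 := e_nonneg hX h0 hK0.le ht0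
  have he1 : X t 4 ≤ 1 := (le_abs_self _).trans (traj_abs_le_one hX h0 t 4)
  have h2010 : 143 / K ^ 20 ≤ 143 / K ^ 10 := by
    apply div_le_div_of_nonneg_left (by norm_num) (by positivity)
    exact pow_le_pow_right₀ hK1 (by norm_num)
  have h143 : 143 / K ^ 10 ≤ 200 / K ^ 10 :=
    div_le_div_of_nonneg_right (by norm_num) (by positivity)
  have hsq : ∀ x : ℝ, x ^ 2 ≤ 143 / K ^ 20 → |x| ≤ 200 / K ^ 10 := by
    intro x hx
    have hx' : x ^ 2 ≤ (12 / K ^ 10) ^ 2 := by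
      rw [div_pow, show (K ^ 10) ^ 2 = K ^ 20 by ring]
      exact hx.trans (div_le_div_of_nonneg_right (by norm_num) (by positivity))
    calc |x| ≤ sqrt ((12 / K ^ 10) ^ 2) := abs_le_sqrt hx'
      _ = 12 / K ^ 10 := sqrt_sq (by positivity)
      _ ≤ 200 / K ^ 10 := div_le_div_of_nonneg_right (by norm_num) (by positivity)
  have hx0 : X t 0 ^ 2 ≤ 143 / K ^ 20 := by
    nlinarith [sq_nonneg (X t 1), sq_nonneg (X t 2), sq_nonneg (X t 3)]
  have hx1 : X t 1 ^ 2 ≤ 143 / K ^ 20 := by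
    nlinarith [sq_nonneg (X t 0), sq_nonneg (X t 2), sq_nonneg (X t 3)]
  have hx2 : X t 2 ^ 2 ≤ 143 / K ^ 20 := by
    nlinarith [sq_nonneg (X t 0), sq_nonneg (X t 1), sq_nonneg (X t 3)]
  have hx3 : X t 3 ^ 2 ≤ 143 / K ^ 20 := by
    nlinarith [sq_nonneg (X t 0), sq_nonneg (X t 1), sq_nonneg (X t 2)]
  have ha := hsq _ hx0
  have hb := hsq _ hx1
  have hc := hsq _ hx2
  have hd := hsq _ hx3
  refine ⟨?_, ?_⟩
  · rw [abs_sub_comm, abs_of_nonneg (by linarith)]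
    have : 1 - X t 4 ≤ 1 - X t 4 ^ 2 := by nlinarith
    linarith
  · intro i hi
    fin_cases i
    · exact ha
    · exact hb
    · exact hc
    · exact hd
    · exact absurd rfl hi

/-- (able2) with constant `200`: on `[0, t_c]`. [cite: Tao2016AveragedNS, §5.5 (able2)] -/
theorem able_window (hX : ∀ t, HasDerivAt X (delayCircuit K ε (X t)) t) (h0 : IsKicked K ε κ X)
    (hε : 0 < ε) (hε1 : ε ≤ 1) (hK : 16 ≤ K) (hεK : ε ^ 2 ≤ 1 / (6 * K ^ 20))
    (hε100 : ε ≤ 1 / K ^ 100) (hτ2 : τ ≤ 2)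
    (hcτ : ∀ t, 0 ≤ t → t ≤ τ → X t 2 ≤ ε ^ 2 / K ^ 10)
    {t : ℝ} (ht : t ∈ Icc 0 τ) :
    |X t 0 - 1| ≤ 200 / K ^ 10 ∧ ∀ i : Fin 5, i ≠ 0 → |X t i| ≤ 200 / K ^ 10 := by
  have hK0 : 0 < K := by linarith
  have hK1 : 1 ≤ K := by linarith
  have ht2 : t ∈ Icc (0 : ℝ) 2 := ⟨ht.1, ht.2.trans hτ2⟩
  have ha := a_near_one hX h0 hε hε1 hK1 hτ2 hεK hcτ ht
  obtain ⟨hb, hc⟩ := bc_small hX h0 hε hε1 ht2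
  obtain ⟨hd, he⟩ := de_small hX h0 hε hK0 hτ2 hcτ ht
  have h20 : 8 / K ^ 20 ≤ 200 / K ^ 10 := by
    calc 8 / K ^ 20 ≤ 8 / K ^ 10 := by
          apply div_le_div_of_nonneg_left (by norm_num) (by positivity)
          exact pow_le_pow_right₀ hK1 (by norm_num)
      _ ≤ 200 / K ^ 10 := div_le_div_of_nonneg_right (by norm_num) (by positivity)
  have h5 : 5 * ε ≤ 200 / K ^ 10 := by
    have h1 : 1 / K ^ 100 ≤ 1 / K ^ 10 := by
      apply div_le_div_of_nonneg_left (by norm_num) (by positivity)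
      exact pow_le_pow_right₀ hK1 (by norm_num)
    have h2 : 5 * (1 / K ^ 10) ≤ 200 / K ^ 10 := by
      rw [mul_one_div]; exact div_le_div_of_nonneg_right (by norm_num) (by positivity)
    linarith
  have h3 : 3 / K ^ 10 ≤ 200 / K ^ 10 := div_le_div_of_nonneg_right (by norm_num) (by positivity)
  have hb' := hb.trans h5
  have hc' := hc.trans h5
  have hd' := hd.trans h3
  have he' := he.trans h3
  refine ⟨ha.trans h20, ?_⟩
  intro i hi
  fin_cases i
  · exact absurd rfl hi
  · exact hb'
  · exact hc'
  · exact hd'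
  · exact he'

end Decay
end Thm53Kick

/-! ## Theorem 5.3 for the kicked datum -/

/-- The kicked datum with no kick is the designed datum (5.6). [cite: Tao2016AveragedNS, §5.5 (5.6)] -/
theorem kickInit_zero : kickInit 0 = delayInit := by
  ext i
  fin_cases i <;> simp [kickInit, delayInit]

/-- The tolerance is at most half the square of the pump amplitude: `kickTolerance K ε ≤ ε²/2`
(`K ≥ 1`). [folklore] -/
theorem kickTolerance_le_half_sq {K ε : ℝ} (hK : 1 ≤ K) : kickTolerance K ε ≤ ε ^ 2 / 2 := by
  calc kickTolerance K ε ≤ ε ^ 2 * (1 / 2) :=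
        mul_le_mul_of_nonneg_left (Thm53Kick.exp_tol_le_half hK) (sq_nonneg ε)
    _ = ε ^ 2 / 2 := by ring

/-- Arithmetic of the threshold `K₀ = 8¹¹¹·111! + 2·20⁴²·42! + 16` of the tree's proof of
Theorem 5.3: `K ≥ 16`, `√K ≥ 512`, `(200+2)/√K ≤ 2/5`. [folklore] -/
theorem K0_facts {K : ℝ}
    (hK : (8 : ℝ) ^ 111 * (Nat.factorial 111 : ℝ) + 2 * 20 ^ 42 * (Nat.factorial 42 : ℝ) + 16 ≤ K) :
    16 ≤ K ∧ 512 ≤ sqrt K ∧ (200 + 2) / sqrt K ≤ 2 / 5 := by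
  have hB : (0 : ℝ) ≤ 2 * 20 ^ 42 * (Nat.factorial 42 : ℝ) := by positivity
  have hf : (1 : ℝ) ≤ (Nat.factorial 111 : ℝ) := by
    exact_mod_cast Nat.succ_le_of_lt (Nat.factorial_pos 111)
  have h8 : (262144 : ℝ) ≤ (8 : ℝ) ^ 111 := by norm_num
  have h8' : (8 : ℝ) ^ 111 ≤ (8 : ℝ) ^ 111 * (Nat.factorial 111 : ℝ) := by
    have h80 : (0 : ℝ) ≤ (8 : ℝ) ^ 111 := by positivity
    nlinarith
  have hK2 : (262144 : ℝ) ≤ K := by linarith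
  have hs : 512 ≤ sqrt K := by
    rw [show (512 : ℝ) = sqrt (512 ^ 2) by rw [sqrt_sq (by norm_num)]]
    exact sqrt_le_sqrt (by norm_num; linarith)
  refine ⟨by linarith, hs, ?_⟩
  rw [div_le_iff₀ (by linarith)]; linarith

/-- `13K¹⁵ε ≤ 1` for `K ≥ 16`, `0 < ε ≤ K⁻¹⁰⁰` (the smallness used by `TriggerFragility.lean`).
[folklore] -/
theorem thirteen_K15_eps_le {K ε : ℝ} (hK : 16 ≤ K) (hε : 0 < ε) (hε100 : ε ≤ 1 / K ^ 100) :
    13 * K ^ 15 * ε ≤ 1 := by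
  have hK0 : 0 < K := by linarith
  have h13 : 13 * K ^ 15 ≤ K ^ 100 := by
    have h85 : (13 : ℝ) ≤ K ^ 85 := le_trans (by norm_num) (pow_le_pow_left₀ (by norm_num) hK 85)
    calc 13 * K ^ 15 ≤ K ^ 85 * K ^ 15 := mul_le_mul_of_nonneg_right h85 (by positivity)
      _ = K ^ 100 := by ring
  calc 13 * K ^ 15 * ε ≤ K ^ 100 * (1 / K ^ 100) := mul_le_mul h13 hε100 hε.le (by positivity)
    _ = 1 := by field_simp

open Thm53Kick in
/-- **Theorem 5.3 survives a kick of the trigger below the tolerance (explicit constants).** For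
`K ≥ K₀ = 8¹¹¹·111! + 2·20⁴²·42! + 16`, `0 < ε ≤ ε₁(K) = e^{-10K¹⁰}/K¹⁰⁰` and
`0 ≤ κ ≤ kickTolerance K ε = ε²e^{-K¹⁰ + K⁹√K/4}`, EVERY global solution of (5.5) from the kicked
datum `kickInit κ` performs the delayed abrupt energy transition with `C = 200` — the constants of
the tree's proof for the designed datum (`DelayedAbruptTransition_holds`), `t_c` = the first time `c`
reaches `K⁻¹⁰ε²`. [cite: Tao2016AveragedNS, Theorem 5.3] -/
theorem kick_hasAbruptTransition {K ε κ : ℝ} {X : ℝ → Fin 5 → ℝ}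
    (hK : (8 : ℝ) ^ 111 * (Nat.factorial 111 : ℝ) + 2 * 20 ^ 42 * (Nat.factorial 42 : ℝ) + 16 ≤ K)
    (hε : 0 < ε) (hεle : ε ≤ exp (-(10 * K ^ 10)) / K ^ 100) (hκ0 : 0 ≤ κ)
    (hκ : κ ≤ kickTolerance K ε) (h0 : X 0 = kickInit κ)
    (hX : ∀ t, HasDerivAt X (delayCircuit K ε (X t)) t) : HasAbruptTransition 200 K X := by
  have hK16 : 16 ≤ K := (K0_facts hK).1
  have hK0 : 0 < K := by linarith
  have hK1 : 1 ≤ K := by linarith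
  have hA : (0 : ℝ) ≤ (8 : ℝ) ^ 111 * (Nat.factorial 111 : ℝ) := by positivity
  have hB : (0 : ℝ) ≤ 2 * 20 ^ 42 * (Nat.factorial 42 : ℝ) := by positivity
  have hN3 : K ^ 110 ≤ exp (K / 8) := Thm53.numeric_N3 (by linarith)
  have hN4 : 2 * exp ((1 - sqrt K) / 10) ≤ 1 / K ^ 20 := Thm53.numeric_N4 hK16 (by linarith)
  obtain ⟨hε1, hεK, hε100, -⟩ := Thm53.eps_facts hK16 hε hεle
  have hεexp := eps_facts' hK16 hε hεle
  have hk : IsKicked K ε κ X := IsKicked.of_le_tolerance hK1 hε hε1 hκ0 hκ h0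
  -- the critical time: first hitting time of the level `K⁻¹⁰ε²` by `c` on `[0,2]`
  obtain ⟨τ, hτ0, hτ2, hcτ, hτeq⟩ := Thm53.exists_hitTime (Thm53.continuous_traj hX 2)
    (θ := ε ^ 2 / K ^ 10) (T := 2) two_pos (by rw [init_c hk]; exact hk.lt_level hK16 hε)
  obtain ⟨hearly, hlate, hτ1, hτ74, hcτeq⟩ := tc_window hX hk hε hε1 hK16 hεK hτ0 hτ2 hcτ hτeq
  obtain ⟨hs0, hs4, hKs, h4, hKs2⟩ := Thm53.invSqrt_facts hK16
  refine ⟨τ, ?_, ?_, ?_⟩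
  · -- (tcable)
    have h200 : (sqrt K)⁻¹ ≤ 200 / sqrt K := by
      rw [div_eq_mul_inv]; nlinarith
    rw [abs_le]; constructor <;> linarith
  · -- (able2)
    intro t ht
    have ht' : t ∈ Icc 0 τ := ⟨ht.1, by rw [one_div] at ht; linarith [ht.2]⟩
    exact able_window hX hk hε hε1 hK16 hεK hε100 hτ2 hcτ ht'
  · -- (beable)
    intro t ht
    have ht0 : 0 ≤ t := by rw [one_div] at ht; linarith
    exact beable_of_sum_sq hX hk hK16 ht0
      (late_sum_sq hX hk hε hε1 hK16 hεK hε100 hεexp hN3 hN4 hτ1 hτ74 hcτ hcτeq ht)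

open Thm53Kick in
/-- **The internal time-scales survive the kick.** For `K ≥ K₀`, `0 < ε ≤ ε₁(K)`,
`0 ≤ κ ≤ kickTolerance K ε` and a global solution `X` of (5.5) from `kickInit κ`: there is a critical
time `t_c ∈ [√2 - 1/√K, √2 + 1/√K]` (the SAME window as for the designed datum) with (boots)/(c-bound)
`c ≤ K⁻¹⁰ε²` on `[0,t_c]`, `c(t_c) = K⁻¹⁰ε²`; (c-large) `c ≥ K¹⁰⁰ε²` on `[t_c + K⁻⁹, 2]`; (atc)
`ã(t_c + 1/K) ≥ 1/10`; and `a²+b²+c²+d² ≤ 143K⁻²⁰` from `t_c + 1/√K` on.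
[cite: Tao2016AveragedNS, §5.5 proof of Theorem 5.3 ((boots), (c-bound), (c-large), (atc), (beable))] -/
theorem kick_internal_timescales {K ε κ : ℝ} {X : ℝ → Fin 5 → ℝ}
    (hK : (8 : ℝ) ^ 111 * (Nat.factorial 111 : ℝ) + 2 * 20 ^ 42 * (Nat.factorial 42 : ℝ) + 16 ≤ K)
    (hε : 0 < ε) (hεle : ε ≤ exp (-(10 * K ^ 10)) / K ^ 100) (hκ0 : 0 ≤ κ)
    (hκ : κ ≤ kickTolerance K ε) (h0 : X 0 = kickInit κ)
    (hX : ∀ t, HasDerivAt X (delayCircuit K ε (X t)) t) :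
    ∃ tc : ℝ, Real.sqrt 2 - 1 / Real.sqrt K ≤ tc ∧ tc ≤ Real.sqrt 2 + 1 / Real.sqrt K ∧
      (∀ t ∈ Set.Icc 0 tc, X t 2 ≤ ε ^ 2 / K ^ 10) ∧ X tc 2 = ε ^ 2 / K ^ 10 ∧
      (∀ t ∈ Set.Icc (tc + 1 / K ^ 9) 2, K ^ 100 * ε ^ 2 ≤ X t 2) ∧
      1 / 10 ≤ X (tc + 1 / K) 4 ∧
      (∀ t, tc + 1 / Real.sqrt K ≤ t →
        X t 0 ^ 2 + X t 1 ^ 2 + X t 2 ^ 2 + X t 3 ^ 2 ≤ 143 / K ^ 20) := by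
  have hK16 : 16 ≤ K := (K0_facts hK).1
  have hK0 : 0 < K := by linarith
  have hK1 : 1 ≤ K := by linarith
  have hA : (0 : ℝ) ≤ (8 : ℝ) ^ 111 * (Nat.factorial 111 : ℝ) := by positivity
  have hB : (0 : ℝ) ≤ 2 * 20 ^ 42 * (Nat.factorial 42 : ℝ) := by positivity
  have hN3 : K ^ 110 ≤ exp (K / 8) := Thm53.numeric_N3 (by linarith)
  have hN4 : 2 * exp ((1 - sqrt K) / 10) ≤ 1 / K ^ 20 := Thm53.numeric_N4 hK16 (by linarith)
  obtain ⟨hε1, hεK, hε100, -⟩ := Thm53.eps_facts hK16 hε hεle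
  have hεexp := eps_facts' hK16 hε hεle
  have hk : IsKicked K ε κ X := IsKicked.of_le_tolerance hK1 hε hε1 hκ0 hκ h0
  obtain ⟨τ, hτ0, hτ2, hcτ, hτeq⟩ := Thm53.exists_hitTime (Thm53.continuous_traj hX 2)
    (θ := ε ^ 2 / K ^ 10) (T := 2) two_pos (by rw [init_c hk]; exact hk.lt_level hK16 hε)
  obtain ⟨hearly, hlate, hτ1, hτ74, hcτeq⟩ := tc_window hX hk hε hε1 hK16 hεK hτ0 hτ2 hcτ hτeq
  refine ⟨τ, by rw [one_div]; exact hearly, by rw [one_div]; exact hlate,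
    fun t ht => hcτ t ht.1 ht.2, hcτeq, ?_, ?_, ?_⟩
  · intro t ht
    rw [one_div] at ht
    exact c_large hX hk hε hε1 hK16 hεK hεexp hN3 hτ1 hτ2 hcτ hcτeq ht
  · rw [one_div K]
    exact e_tenth hX hk hε hε1 hK16 hεK hεexp hN3 hτ1 hτ74 hcτ hcτeq
  · intro t ht
    exact late_sum_sq hX hk hε hε1 hK16 hεK hε100 hεexp hN3 hN4 hτ1 hτ74 hcτ hcτeq ht

/-- **Trigger tolerance, Theorem 5.3-shaped.** There are an absolute constant `C` and a threshold
`K₀` such that for `K ≥ K₀` there is `ε₁ = ε₁(K) > 0` with: for `0 < ε ≤ ε₁` and every kick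
`0 ≤ κ ≤ kickTolerance K ε` of the trigger mode, every global solution of (5.5) from
`kickInit κ = (√(1-κ²), 0, κ, 0, 0)` performs the delayed abrupt energy transition of Theorem 5.3
with constants `C, K`. (At `κ = 0` this is `DelayedAbruptTransition` itself, `kickInit_zero`.)
[cite: Tao2016AveragedNS, Theorem 5.3] -/
theorem hasAbruptTransition_of_kick_le_tolerance :
    ∃ C : ℝ, 0 < C ∧ ∃ K₀ : ℝ, 0 < K₀ ∧ ∀ K : ℝ, K₀ ≤ K → ∃ ε₁ : ℝ, 0 < ε₁ ∧
      ∀ ε : ℝ, 0 < ε → ε ≤ ε₁ → ∀ κ : ℝ, 0 ≤ κ → κ ≤ kickTolerance K ε →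
        ∀ X : ℝ → Fin 5 → ℝ, X 0 = kickInit κ →
          (∀ t, HasDerivAt X (delayCircuit K ε (X t)) t) → HasAbruptTransition C K X := by
  have hA : (0 : ℝ) ≤ (8 : ℝ) ^ 111 * (Nat.factorial 111 : ℝ) := by positivity
  have hB : (0 : ℝ) ≤ 2 * 20 ^ 42 * (Nat.factorial 42 : ℝ) := by positivity
  refine ⟨200, by norm_num,
    (8 : ℝ) ^ 111 * (Nat.factorial 111 : ℝ) + 2 * 20 ^ 42 * (Nat.factorial 42 : ℝ) + 16,
    by linarith, fun K hK => ?_⟩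
  have hK0 : 0 < K := by linarith
  exact ⟨exp (-(10 * K ^ 10)) / K ^ 100, by positivity,
    fun ε hε hεle κ hκ0 hκ X h0 hX => kick_hasAbruptTransition hK hε hεle hκ0 hκ h0 hX⟩

/-! ## The sandwich with `TriggerFragility.lean` -/

/-- **The tolerance is below the threshold.** With the constants of the tree's proof of Theorem 5.3
(`C = 200`, `K ≥ K₀`, `0 < ε ≤ ε₁(K)`):
`kickTolerance K ε < kickThreshold K ε (200K⁻¹⁰) (√2 - 202/√K)` — a kick equal to the tolerance
fires on time (`kick_hasAbruptTransition`), a kick at the threshold fires early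
(`TriggerFragility.not_hasAbruptTransition_of_kick`), and a solution from the kicked datum exists.
[cite: Tao2016AveragedNS, Theorem 5.3] -/
theorem kickTolerance_lt_kickThreshold {K ε : ℝ}
    (hK : (8 : ℝ) ^ 111 * (Nat.factorial 111 : ℝ) + 2 * 20 ^ 42 * (Nat.factorial 42 : ℝ) + 16 ≤ K)
    (hε : 0 < ε) (hεle : ε ≤ exp (-(10 * K ^ 10)) / K ^ 100) :
    kickTolerance K ε <
      kickThreshold K ε (200 / K ^ 10) (Real.sqrt 2 - (200 + 2) / Real.sqrt K) := by
  obtain ⟨hK16, hs512, h202⟩ := K0_facts hK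
  have hK1 : 1 ≤ K := by linarith
  obtain ⟨hε1, -, hε100, -⟩ := Thm53.eps_facts hK16 hε hεle
  have hKε := thirteen_K15_eps_le hK16 hε hε100
  have hC8 : 8 * (200 : ℝ) ≤ K ^ 10 :=
    le_trans (by norm_num) (pow_le_pow_left₀ (by norm_num) hK16 10)
  have hCK : (200 + 2) / Real.sqrt K < Real.sqrt 2 := by
    have := Thm53.sqrt_two_gt; linarith
  by_contra hle
  have hthr := not_lt.1 hle
  obtain ⟨X, h0, hX⟩ := exists_solution_kickInit K ε (kickTolerance K ε)
  have hpos : HasAbruptTransition 200 K X :=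
    kick_hasAbruptTransition hK hε hεle (kickTolerance_pos hε).le le_rfl h0 hX
  have hκsq : kickTolerance K ε ≤ ε ^ 2 :=
    (kickTolerance_le_half_sq hK1).trans (by nlinarith [sq_nonneg ε])
  exact not_hasAbruptTransition_of_kick hX h0 hK1 hε hKε (kickTolerance_pos hε) hκsq
    (by norm_num) hC8 hCK hthr hpos

/-- **Two-sided trigger tolerance of the delay circuit (5.5)/(5.6).** With the absolute constant
`C = 200` and the threshold `K₀` of the tree's proof of Theorem 5.3: for `K ≥ K₀` and
`0 < ε ≤ ε₁(K) = e^{-10K¹⁰}/K¹⁰⁰`,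
`0 < kickTolerance K ε < kickThreshold K ε (CK⁻¹⁰) (√2 - (C+2)/√K) ≤ ε²`, and for a pre-load `κ`
of the trigger mode `c` (datum `kickInit κ`, any global solution of (5.5)):
* `0 ≤ κ ≤ kickTolerance K ε = ε²e^{-K¹⁰ + K^{9.5}/4}` ⟹ the delayed abrupt transition with
  constants `C, K` DOES take place (this file);
* `kickThreshold K ε … ≤ κ ≤ ε²` (`kickThreshold = ε²e^{-K¹⁰ + √2(C+2)K^{9.5} - O((C+2)²K⁹)}` up to
  `e^{o(K⁹)}` factors) ⟹ it does NOT (`TriggerFragility.lean`: the gate fires early).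
So the kick tolerance of the trigger channel is the seed scale `ε²e^{-K¹⁰}` times `e^{Θ(K^{9.5})}`,
kernel-checked from both sides. [cite: Tao2016AveragedNS, Theorem 5.3] -/
theorem trigger_tolerance :
    ∃ C : ℝ, 0 < C ∧ ∃ K₀ : ℝ, 0 < K₀ ∧ ∀ K : ℝ, K₀ ≤ K → ∃ ε₁ : ℝ, 0 < ε₁ ∧
      ∀ ε : ℝ, 0 < ε → ε ≤ ε₁ →
        0 < kickTolerance K ε ∧
        kickTolerance K ε < kickThreshold K ε (C / K ^ 10) (Real.sqrt 2 - (C + 2) / Real.sqrt K) ∧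
        kickThreshold K ε (C / K ^ 10) (Real.sqrt 2 - (C + 2) / Real.sqrt K) ≤ ε ^ 2 ∧
        (∀ κ : ℝ, 0 ≤ κ → κ ≤ kickTolerance K ε → ∀ X : ℝ → Fin 5 → ℝ, X 0 = kickInit κ →
          (∀ t, HasDerivAt X (delayCircuit K ε (X t)) t) → HasAbruptTransition C K X) ∧
        (∀ κ : ℝ, kickThreshold K ε (C / K ^ 10) (Real.sqrt 2 - (C + 2) / Real.sqrt K) ≤ κ →
          κ ≤ ε ^ 2 → ∀ X : ℝ → Fin 5 → ℝ, X 0 = kickInit κ →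
            (∀ t, HasDerivAt X (delayCircuit K ε (X t)) t) → ¬ HasAbruptTransition C K X) := by
  have hA : (0 : ℝ) ≤ (8 : ℝ) ^ 111 * (Nat.factorial 111 : ℝ) := by positivity
  have hB : (0 : ℝ) ≤ 2 * 20 ^ 42 * (Nat.factorial 42 : ℝ) := by positivity
  refine ⟨200, by norm_num,
    (8 : ℝ) ^ 111 * (Nat.factorial 111 : ℝ) + 2 * 20 ^ 42 * (Nat.factorial 42 : ℝ) + 16,
    by linarith, fun K hK => ?_⟩
  obtain ⟨hK16, hs512, h202⟩ := K0_facts hK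
  have hK0 : 0 < K := by linarith
  have hK1 : 1 ≤ K := by linarith
  have hK2 : 2 ≤ K := by linarith
  have hC8 : 8 * (200 : ℝ) ≤ K ^ 10 :=
    le_trans (by norm_num) (pow_le_pow_left₀ (by norm_num) hK16 10)
  have h72 := Thm53.sqrt_two_gt
  have hCK : (200 + 2) / Real.sqrt K < Real.sqrt 2 := by linarith
  have hs1 : 1 ≤ Real.sqrt 2 - (200 + 2) / Real.sqrt K := by linarith
  have hγ : 200 / K ^ 10 ≤ (1 : ℝ) / 8 := by
    rw [div_le_div_iff₀ (by positivity) (by norm_num)]; linarith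
  refine ⟨exp (-(10 * K ^ 10)) / K ^ 100, by positivity, fun ε hε hεle => ?_⟩
  obtain ⟨hε1, -, hε100, -⟩ := Thm53.eps_facts hK16 hε hεle
  have hKε := thirteen_K15_eps_le hK16 hε hε100
  refine ⟨kickTolerance_pos hε, kickTolerance_lt_kickThreshold hK hε hεle,
    kickThreshold_le_sq hK2 hε hKε hγ hs1,
    fun κ hκ0 hκ X h0 hX => kick_hasAbruptTransition hK hε hεle hκ0 hκ h0 hX,
    fun κ hthr hκ X h0 hX => ?_⟩
  exact not_hasAbruptTransition_of_kick hX h0 hK1 hε hKε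
    (lt_of_lt_of_le (kickThreshold_pos hK0 hε) hthr) hκ (by norm_num) hC8 hCK hthr

end Literature.Analysis.FluidPDE.Tao2016AveragedNS
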